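import Summits.QuantumFields.YangMills.Theorems.BalabanUVNodesK1RunRowsOfU2Letters
import Summits.QuantumFields.YangMills.Theorems.BalabanUVNodesN18CornerBandOfKernelLetters
import Summits.QuantumFields.YangMills.Theorems.BalabanUVNodesK2CornerRoadSign
import Summits.QuantumFields.YangMills.Theorems.BalabanUVNodesK1R9VersionSlotDefs

/-!
# Idea-7 (inversion lens) — T8♭ IN RUN CURRENCY + the R-BM re-cut of the displayed-(0.31)-run road (crux workfile, cell `ym-nodeO-ideate`)

HEADER (placement per director-ym №24 (e) ∕ №31). Carrier item: stmt-QuantumFields-20543 (`…Theses.BalabanUVNodes.EndpointGivenBR13SepCoPH`, ASIDE on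
route-QuantumFields-BalabanUVNodes rev 29). The statements below bear on the DECIDING crux **stmt-QuantumFields-27364**
`…Theses.BalabanUVNodes.StabilityBRunRowsAtRecordR13SepCoPHV` (K1⁹; rows (i) fixed-radius run remainder, (iv) run-wise partial-sum floor, (C) survivor continuity)
and are keyed to DEF-1's `RunRowsCont13` ∕ `RowsContAll` (p622006) BY NAME. Companion of this seat's kernel `Cruxes/EndpointGivenBR13SepCoPH/Idea7V7cCornerNecessity.lean`
(ED.3.4, commit 1f557a66c098; §10 there = T8♭ `anchor_windowFloor_of_histLipschitz_runwiseFloor`, T9♭ʳⱽ) — NOT imported here (kept standalone); its names are cited in docstrings.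

EDITION 2 (g13, 2026-08-28 ≈11:4xZ; ED.1 = commit f21218a7d336): (i) DEF-1's `Theorems.BalabanUVNodesK1R9VersionSlotDefs` (p624736) now IMPORTED (its oleans reached the farm with
PORT-1's p626226) — §B.1 gains ★ `stabilityBRunRowsAtRecordR13SepCoPHV_of_k17_rowMassRunsAll : StabilityBAtRecordR13SepCoPH → RowMassRunsAll → StabilityBRunRowsAtRecordR13SepCoPHV`,
concluding THE DECIDING CRUX DECL (stmt-QuantumFields-27364) BY NAME from the aside K1⁷ + the (α♭) letter (CONDITIONAL; nothing closed); (ii) §C gains TOY G `betaBlk` — the CONVERSE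
separation: a history-free β with values in {1, 2} on blocks [m², (m+1)²) carries (α♭) (zero modulus, runs of every depth with `Discrete031 1 2`), the anchor `cBlk`, K1⁹'s three rows at
every level (radius 0, floor 0) — and NO `OneLoopDrift s A b` for ANY anchored `b` and ANY slope `s` (`no_anchoredDrift_betaBlk`): 2ᶜᴰ's drift letter is NOT implied by (α♭) + U3ᴷ-lite +
rows, so LINE α♭ and LINE R♭ are INCOMPARABLE on the β side (TOY ALT the other way), and T14♭'s bracket «drift s>0 ⟹ ROWS» is strict at the top OFF the seam, among AF-like β's with
(0.31)-runs (window averages in [1, 2]).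

HONEST SCOPE. Nothing here proves the Yang–Mills mass gap (Clay), Bałaban's Theorem 2, any letter about Bałaban's β, or any item of the route; R4 closes only the
CONDITIONAL finite-𝕋⁴ rung `BalabanLadder.UV`. Every theorem is either [folklore] real analysis about an abstract history-dependent recursion
`1∕g²_{k+1} = 1∕g²_k + β_k(g_0,…,g_k)` ([I] (0.20) p.256) or a TOY MODEL declared here. Nothing advances 27364's count.

WHAT THIS FILE ANSWERS. CRIT-2 ROUND 7 (HOME STATUS 10:49:25Z, sheet `CRIT-2-ROUND7-corner-limit-sign.md` 5e9d4d9380fc) left ONE open point on card ED.8: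
«state T8♭ in RUN currency — a fixed-r `RunConstRemainder β N r γ₀` floors N's partial sums only to −M − (n−k)·r, so the corner floor transfers to the run road only
with a g-proportional ∕ vanishing run remainder; say which.»  §A says which, as theorems:
* `RunRemAtLevels β N ℓ ρ γ₀` := along every in-window solution of (0.20) at EVERY level `0 < δ ≤ γ₀`, `|β_k(g_0..g_k) − N_k| ≤ ℓ_k·δ + ρ_k` (a δ-PROPORTIONAL part with
  scale-dependent constant `ℓ_k ≥ 0` plus a δ-FREE residual `ρ_k ≥ 0`).
* TRANSFER (`windowFloor_of_runwiseFloor_runRemAtLevels`): run-wise floor −M at level γ₀ + `RunRemAtLevels` ⟹ `−M − Σ_{[k,n)} ρ_j ≤ Σ_{[k,n)} N_j` for every window.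
  So: PROPORTIONAL (ρ ≡ 0) ⟹ the floor transfers VERBATIM (`…_propRadius`); SUMMABLE ρ ⟹ it transfers up to `−Σρ`; a constant N ≡ c is then floored to `0 ≤ c`
  (`const_nonneg_of_windowFloor`).
* INSTANCES: (a) the corner road — `HistLipschitz Λ γ β` ALONE gives `RunRemAtLevels β b (k ↦ Σ_i |Λ_{k,i}|) 0 γ` at the McShane anchor `b` (N18's band BY NAME), so the
  kernel's T8♭ IS the proportional instance (`anchor_windowFloor_via_runCurrency`, mass-free, scale-dependent ℓ_k); (b) idea-5's S-LIN letter `|β_k − b_k| ≤ A·g_k` along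
  runs is the proportional instance with ℓ ≡ A; (c) bflow-p2's NE4 sandwich `|β_k(v) − b⋆| ≤ 2Cδ∕(1−θ) + cθ^k∕(1−θ)` (`…PointwiseFadingLimit.abs_beta_sub_bstar_le`) is the
  SUMMABLE instance, and the transfer re-derives #70d's `bstar_nonneg_of_runPS` conclusion `0 ≤ b⋆` by a different route (`bstar_nonneg_via_runCurrency`).
* NO-GO for a FIXED radius (`fixedRadius_noTransfer`): `β ≡ 0`, `b ≡ −r` satisfies K1⁹'s rows (i) (radius r), (iv) (M = 0) and (C) at every level — the full rows
  triple WITH THIS b — while `Σ_{[k,n)} b_j = −r(n−k) → −∞`.  Hence T8♭ is a tax on the SUPPLIER ROADS (every located supplier — corner∕McShane, S-LIN, R-BM, (α♭) below —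
  pays it), NOT on the crux text: K1⁹ BY NAME floors its own named `b` only through an extra letter (kernel T9♭ʳⱽ: `HistLipschitz`; or S-LIN).

§B — THE R-BM RE-CUT OF bflow-p2's (α) ROAD (inversion of the 10:42Z supplier class; attribution: b2b-balaban-beta-bflow-p2 gen 50 #70a p622202
`…B12AsPrintedPointwiseFadingRunRows`, #70b p623153 `…Theorems.BalabanUVNodesK1RunRowsOfU2Letters`, part 10 `…PointwiseFadingDrift.betaAvgAFH_of_runs_fadingMemory`;
CRIT-2 E-CRIT2-2 R-BM (HOME STATUS S.2003: FadingMemory ↦ bounded row-sum mass); PORT-1 p622247 `U3LiteK`).  bflow-p2's road is typed over `FadingMemory C θ Λ`, recorded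
presumptively DEAD at the record mod F-E (idea-5 BN-N; kernel §9b `not_histLipschitz_fadingMemory_betaMT`; S-1 twins `Crit2ModulusPrefactorToy` 82404d4e70bf ∕ `Crit1ShiftOscToy`
27594dd1d250).  Read BACKWARDS, the fading letter is NOT load-bearing: with only `HistLipschitz Λ γ β` + a ROW-MASS bound `Σ_i |Λ_{k,i}| ≤ L` (U3ᴷ-lite currency) + the displayed
lower-(0.31) run family at slope `s > 0`, the EXTREMAL PROFILE `u_i = 1∕√(1∕γ² + s(K−i))` majorises every run entry, `Σ_{[k,K)} u ≤ 2√(K−k)∕√s` (bflow's own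
`sum_run_le_of_discrete031` BY NAME applied to u), and moving the run to the constant history costs `L(u_j + δ)` per scale ⟹
**`betaAvgAFH_of_runs_rowMass`: `BetaAvgAFH (s∕4) (4L²∕s²) δ β` for `4Lδ ≤ s`** — fading-FREE, NE4-FREE, with a SMALLER defect than part 10's `4C²∕((1−θ)²s²) + Cγθ∕(1−θ)²`
(re-derived as the corollaries `betaAvgAFH_of_runs_fadingMemory_sharper` ∕ `…_literal`).  Hence the rows: `rowsTriple_of_runs_rowMass` (b_k = β_k(γ₀,…,γ₀), r = Lγ₀, M = 4L²∕s², (C) from the moduli),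
keyed `runRowsCont13_of_rowMass_runs` ∕ `runRowsCont13_of_typedTheorem2_rowMass` ∕ `rowsContAll_of_rowMassRunsAll` ∕ `endpointGivenBR13SepCoPH_of_rowMassRunsAll` (the carrier K2⁷
20543 BY NAME) ∕ `stabilityBRunRowsAtRecordR13SepCoPH_of_k17_rowMassRunsAll` (K1⁸ aside 26907; K1⁹ 27364 follows by DEF-1's door `…K1R9VersionSlotDefs.stabilityBRunRowsAtRecordR13SepCoPHV_of_k1R8` BY NAME — cited in ED.1 while that
module lagged on the farm; ED.2 IMPORTS it: ★ `stabilityBRunRowsAtRecordR13SepCoPHV_of_k17_rowMassRunsAll` concludes 27364's decl BY NAME).  READING: K1⁹'s rows conjunct ≤ «[I] Thm 2 AS TYPED at one endpoint + `hrg` + U3ᴷ-lite», BN-N-free mod F-E.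

§C — PRICE ∕ SEPARATION of the (α♭) input.  `topStep_lower_of_discrete031`: a displayed (0.31)-run of depth K ≥ 1 carries the POINTWISE sign datum `s ≤ β_{K−1}(run)`;
TOY ALT (`betaAlt_k ≡ −1 ∕ 3` alternating): HistLipschitz with zero modulus, McShane anchor, `OneLoopDrift 1 2`, rows (i)(iv)(C) — the whole 2ᶜᴰ∕corner currency — yet NO
(0.31)-run of depth 1 at any slope s > 0 (`no_run031_betaAlt`): the (α♭) input is NOT implied by the corner currency; TOY F (`betaMT`, kernel §9b re-declared) INHABITS (α♭)
(`alphaFlat_inhabited_betaMT`) where the fading ∕ NE4 roads are empty; TOY G (ED.2, `betaBlk`: values 1∕2 on the blocks [m², (m+1)²)): (α♭) + anchor + rows at every level and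
NO `OneLoopDrift s A b` for any anchored b, any slope (`no_anchoredDrift_betaBlk`) — the converse separation: 2ᶜᴰ is NOT implied by (α♭) + U3ᴷ-lite + rows.

Cell rule: other seats' results are cited BY NAME or re-declared with attribution; no kernel of another seat is imported.
[cite: Balaban1987RG1, Thm 2 (0.31) p.259 with (0.20) p.256, Thm 3 p.264, §1 pp.263–264, (5.10) p.293, §5 p.298; Balaban1989LargeFieldII, Thm 1 p.355]
-/

namespace Summit.QuantumFields.YangMills.Cruxes.EndpointGivenBR13SepCoPH.Idea7RunCurrency

open Finset Filter Topology
open Literature.MathematicalPhysics.QuantumFieldTheory.Balaban1983to89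
open Literature.MathematicalPhysics.QuantumFieldTheory.Balaban1983to89.B12BetaAsPrinted (Setting Theorem2Statement)
open Literature.MathematicalPhysics.QuantumFieldTheory.Balaban1983to89.FlowStep (HBeta prefixOf prefixOf_apply Box mem_box box_mono RGEqH BetaContH clampPrefix Y
  inv_sq_telescopeH histBox_eq_box)
open Literature.MathematicalPhysics.QuantumFieldTheory.Balaban1983to89.FlowStepRuns (BetaPartialSumsLowerH genSeq genSeq_zero genSeq_succ solveCoupling solveCoupling_pos
  inv_sq_solveCoupling)
open Literature.MathematicalPhysics.QuantumFieldTheory.Balaban1983to89.T4CouplingMatching (HistLipschitz FadingMemory ScaleShiftRate)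
open Literature.MathematicalPhysics.QuantumFieldTheory.Balaban1983to89.T4BetaStationary (betaInf)
open Literature.MathematicalPhysics.QuantumFieldTheory.Balaban1983to89.Beta.AveragedAFCarrier (BetaAvgAFH)
open Literature.MathematicalPhysics.QuantumFieldTheory.Balaban1983to89.Beta.Drift (OneLoopDrift)
open Literature.MathematicalPhysics.QuantumFieldTheory.Balaban1983to89.T4Continuum (T4Family)
open Summit.QuantumFields.BalabanUV.Gaps.EndRunwiseCone (runwisePS_of_betaPartialSumsLowerH)
open Summit.QuantumFields.BalabanUV.Beta.EriceFlowEnclosureB12AsPrintedTunedUpper (prefixOf_mem_box_of_inInterval)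
open Summit.QuantumFields.BalabanUV.Beta.EriceFlowEnclosureB12AsPrintedPointwiseFaceDrift (sum_run_le_of_discrete031)
open Summit.QuantumFields.BalabanUV.Beta.EriceFlowEnclosureB12AsPrintedPointwiseFading (rowSum_le)
open Summit.QuantumFields.BalabanUV.Beta.EriceFlowEnclosureB12AsPrintedPointwiseFadingDrift (sqrt_absorb runs_of_theorem2)
open Summit.QuantumFields.BalabanUV.Beta.EriceFlowEnclosureB12AsPrintedPointwiseFadingLimit (abs_beta_sub_bstar_le)
open Summit.QuantumFields.BalabanUV.Beta.EriceFlowEnclosureB12AsPrintedPointwiseFadingRunRows (survCont_of_moduli)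
open Summit.QuantumFields.YangMills.Theorems.BalabanUVNodesK2NamedJetsRunRemAt (RunConstRemainder SurvCont)
open Summit.QuantumFields.YangMills.Theorems.BalabanUVNodesK2NamedJetsRemAt (ScaleAnchor)
open Summit.QuantumFields.YangMills.Theorems.BalabanUVNodesK2CornerRoadSign (exists_scaleAnchor_of_histLipschitz)
open Summit.QuantumFields.YangMills.Theorems.BalabanUVNodesK1R8RowsDefs (RunRowsCont13 RowsContAll runRowsCont13_iff_inline rowsContAll_of_adm
  endpointGivenBR13SepCoPH_of_rowsContAll stabilityBRunRowsAtRecordR13SepCoPH_of_k17_rowsContAll)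
open Summit.QuantumFields.YangMills.Theses.BalabanUVNodes (EndpointGivenBR13SepCoPH StabilityBAtRecordR13SepCoPH StabilityBRunRowsAtRecordR13SepCoPH)
open YMDAG.N18.CornerBandOfKernelLetters (abs_sub_le_sum_of_anchor_of_histLipschitz abs_sub_le_mul_of_band)

noncomputable section

/-! ## §0 Two [folklore] helpers -/

/-- `1∕y² ≤ 1∕x²` with `x, y > 0` gives `x ≤ y`. [folklore] -/
theorem le_of_inv_sq_le {x y : ℝ} (hx : 0 < x) (hy : 0 < y) (h : 1 / y ^ 2 ≤ 1 / x ^ 2) : x ≤ y := by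
  by_contra hlt
  have hlt : y < x := not_le.mp hlt
  have h2 : y ^ 2 < x ^ 2 := by nlinarith
  have h3 : 1 / x ^ 2 < 1 / y ^ 2 := one_div_lt_one_div_of_lt (pow_pos hy 2) h2
  linarith

/-- **ROW-MASS TRANSFER** (U3ᴷ-lite currency; CRIT-2 R-BM ∕ PORT-1 p622247 `U3LiteK` re-stated locally, attribution): `HistLipschitz Λ γ β` with `Σ_i |Λ_{k,i}| ≤ L` and two
histories of the γ-box differing coordinatewise by at most `d` ⟹ `|β_j p − β_j q| ≤ L·d`. [folklore] -/
theorem abs_sub_le_rowMass {β : HBeta} {γ L : ℝ} {Λ : ℕ → ℕ → ℝ} (hL : HistLipschitz Λ γ β) (hM : ∀ k, ∑ i : Fin (k + 1), |Λ k i| ≤ L)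
    {j : ℕ} {p q : Fin (j + 1) → ℝ} (hp : p ∈ Box γ j) (hq : q ∈ Box γ j) {d : ℝ} (hd0 : 0 ≤ d) (hd : ∀ i, |p i - q i| ≤ d) :
    |β j p - β j q| ≤ L * d := by
  have h1 := hL j p q hp hq
  have h2 : ∑ i : Fin (j + 1), Λ j i * |p i - q i| ≤ ∑ i : Fin (j + 1), |Λ j i| * d :=
    Finset.sum_le_sum fun i _ =>
      calc Λ j i * |p i - q i| ≤ |Λ j i| * |p i - q i| := mul_le_mul_of_nonneg_right (le_abs_self _) (abs_nonneg _)
        _ ≤ |Λ j i| * d := mul_le_mul_of_nonneg_left (hd i) (abs_nonneg _)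
  rw [← Finset.sum_mul] at h2
  exact h1.trans (h2.trans (mul_le_mul_of_nonneg_right (hM j) hd0))

/-- Row mass is nonnegative, so `0 ≤ L`. [folklore] -/
theorem rowMass_nonneg {Λ : ℕ → ℕ → ℝ} {L : ℝ} (hM : ∀ k, ∑ i : Fin (k + 1), |Λ k i| ≤ L) : 0 ≤ L :=
  (Finset.sum_nonneg fun (i : Fin (0 + 1)) (_ : i ∈ Finset.univ) => abs_nonneg (Λ 0 i)).trans (hM 0)

/-- `FadingMemory C θ Λ` (0 ≤ θ < 1, 0 ≤ C) IS a row-mass bound with `L = C∕(1−θ)` (bflow-p2 part 9's `rowSum_le` BY NAME; entries nonnegative by the letter). [folklore] -/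
theorem rowMass_of_fadingMemory {C θ : ℝ} {Λ : ℕ → ℕ → ℝ} (hθ0 : 0 ≤ θ) (hθ1 : θ < 1) (hC : 0 ≤ C) (hΛ : FadingMemory C θ Λ) (k : ℕ) :
    ∑ i : Fin (k + 1), |Λ k i| ≤ C / (1 - θ) := by
  have h : ∑ i : Fin (k + 1), |Λ k i| = ∑ i : Fin (k + 1), Λ k i :=
    Finset.sum_congr rfl fun i _ => abs_of_nonneg (hΛ k i (Nat.le_of_lt_succ i.isLt)).1
  rw [h]; exact rowSum_le hθ0 hθ1 hC hΛ k

/-! ## §A T8♭ IN RUN CURRENCY (CRIT-2 ROUND 7 open point): which run remainders let the run-wise floor pass to the remainder sequence -/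

/-- HYPOTHESIS SHAPE (never a fact): **RUN-WISE FLOOR at level γ₀** — K1⁹'s row (iv) for an abstract β (same text as the kernel's `Idea7V7cCornerNecessity.RunwiseFloor`, re-declared to keep this file
standalone): along every in-window solution of (0.20) of depth n inside ]0, γ₀], every window sum of β is `≥ −M`. [cite: Balaban1987RG1, Thm 2 p.259 with (0.20) p.256] -/
def RunwiseFloor (β : HBeta) (γ₀ M : ℝ) : Prop :=
  ∀ (n : ℕ) (gs : ℕ → ℝ), RGEqH n β gs → Step.InInterval γ₀ n gs → ∀ k, k ≤ n → -M ≤ ∑ j ∈ Ico k n, β j (prefixOf gs j)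

/-- HYPOTHESIS SHAPE (never a fact): **RUN REMAINDER AT ALL LEVELS** (the run-currency letter CRIT-2 asked for): along every in-window solution of (0.20) at EVERY level `0 < δ ≤ γ₀`,
`|β_k(g_0,…,g_k) − N_k| ≤ ℓ_k·δ + ρ_k` — a δ-PROPORTIONAL part (scale-dependent constant ℓ_k) plus a δ-FREE residual ρ_k.  ρ ≡ 0 = «g-proportional run remainder»;
ℓ ≡ 0, ρ_k → 0 = «vanishing run remainder»; a FIXED radius is ℓ ≡ 0, ρ ≡ r. [cite: Balaban1987RG1, Thm 3 p.264 with (0.20) p.256] -/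
def RunRemAtLevels (β : HBeta) (N : ℕ → ℝ) (ℓ ρ : ℕ → ℝ) (γ₀ : ℝ) : Prop :=
  ∀ δ : ℝ, 0 < δ → δ ≤ γ₀ → ∀ (n : ℕ) (gs : ℕ → ℝ), RGEqH n β gs → Step.InInterval δ n gs →
    ∀ k, k ≤ n → |β k (prefixOf gs k) - N k| ≤ ℓ k * δ + ρ k

theorem RunwiseFloor.mono {β : HBeta} {γ₀ γ₁ M : ℝ} (h : RunwiseFloor β γ₀ M) (hle : γ₁ ≤ γ₀) : RunwiseFloor β γ₁ M :=
  fun n gs hrg hI k hk => h n gs hrg (fun i hi => ⟨(hI i hi).1, (hI i hi).2.trans hle⟩) k hk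

theorem RunRemAtLevels.mono {β : HBeta} {N ℓ ρ : ℕ → ℝ} {γ₀ γ₁ : ℝ} (h : RunRemAtLevels β N ℓ ρ γ₀) (hle : γ₁ ≤ γ₀) : RunRemAtLevels β N ℓ ρ γ₁ :=
  fun δ hδ hδγ => h δ hδ (hδγ.trans hle)

/-- **DEEP IN-WINDOW RUNS EXIST under a run-wise upper bound** (forward generation, [folklore]; the kernel's `deepRun_exists` with the box-wise ceiling replaced by ANY nonnegative
per-scale ceiling `B_j` valid ALONG IN-WINDOW RUNS): start at `g_0` with `1∕g_0² = 1∕δ² + Σ_{j<n} B_j`; by induction the generated run (`FlowStepRuns.genSeq`) stays in ]0, δ]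
with `1∕g_j² ≥ 1∕δ² + Σ_{i∈[j,n)} B_i`, since by (0.20) `1∕g²` falls by at most `B_j` per step. [cite: Balaban1987RG1, (0.18)–(0.20) pp.255–256] -/
theorem deepRun_of_runUpper {β : HBeta} {δ : ℝ} (hδ : 0 < δ) {B : ℕ → ℝ} (hB0 : ∀ j, 0 ≤ B j)
    (hB : ∀ (j : ℕ) (gs : ℕ → ℝ), RGEqH j β gs → Step.InInterval δ j gs → β j (prefixOf gs j) ≤ B j) (n : ℕ) :
    ∃ gs : ℕ → ℝ, RGEqH n β gs ∧ Step.InInterval δ n gs := by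
  set y0 : ℝ := 1 / δ ^ 2 + ∑ j ∈ Ico 0 n, B j with hy0
  have hδ2 : 0 < 1 / δ ^ 2 := by positivity
  have hy0pos : 0 < y0 := by
    have := Finset.sum_nonneg fun j (_ : j ∈ Ico 0 n) => hB0 j
    linarith
  set g0 : ℝ := solveCoupling y0 with hg0
  set gs : ℕ → ℝ := genSeq β g0 with hgs
  have hgs0 : gs 0 = g0 := genSeq_zero β g0
  have key : ∀ j, j ≤ n → (∀ i, i ≤ j → 0 < gs i ∧ gs i ≤ δ) ∧ 1 / δ ^ 2 + ∑ i ∈ Ico j n, B i ≤ 1 / (gs j) ^ 2 ∧ RGEqH j β gs := by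
    intro j
    induction j with
    | zero =>
      intro _
      have hinv : 1 / (gs 0) ^ 2 = y0 := by rw [hgs0]; exact inv_sq_solveCoupling hy0pos
      have hpos : 0 < gs 0 := by rw [hgs0]; exact solveCoupling_pos hy0pos
      refine ⟨fun i hi => ?_, by rw [hinv], fun k hk => absurd hk (Nat.not_lt_zero _)⟩
      obtain rfl : i = 0 := Nat.le_zero.1 hi
      refine ⟨hpos, le_of_inv_sq_le hpos hδ ?_⟩
      rw [hinv, hy0]
      have := Finset.sum_nonneg fun j (_ : j ∈ Ico 0 n) => hB0 j
      linarith
    | succ j ih =>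
      intro hj
      obtain ⟨hbox, hlow, hrg⟩ := ih (Nat.le_of_succ_le hj)
      have hjn : j < n := hj
      have hβle : β j (prefixOf gs j) ≤ B j := hB j gs hrg hbox
      have hsplit : ∑ i ∈ Ico j n, B i = B j + ∑ i ∈ Ico (j + 1) n, B i := Finset.sum_eq_sum_Ico_succ_bot hjn _
      set y' : ℝ := 1 / (gs j) ^ 2 - β j (prefixOf gs j) with hy'
      have hy'low : 1 / δ ^ 2 + ∑ i ∈ Ico (j + 1) n, B i ≤ y' := by rw [hy']; linarith
      have hy'pos : 0 < y' := by
        have := Finset.sum_nonneg fun i (_ : i ∈ Ico (j + 1) n) => hB0 i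
        linarith
      have hsucc : gs (j + 1) = solveCoupling y' := by rw [hgs, genSeq_succ]
      have hinv : 1 / (gs (j + 1)) ^ 2 = y' := by rw [hsucc]; exact inv_sq_solveCoupling hy'pos
      have hpos : 0 < gs (j + 1) := by rw [hsucc]; exact solveCoupling_pos hy'pos
      have hle : gs (j + 1) ≤ δ := by
        refine le_of_inv_sq_le hpos hδ ?_
        rw [hinv]
        have := Finset.sum_nonneg fun i (_ : i ∈ Ico (j + 1) n) => hB0 i
        linarith
      refine ⟨fun i hi => ?_, by rw [hinv]; exact hy'low, fun k hk => ?_⟩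
      · rcases Nat.lt_or_eq_of_le hi with h | h
        · exact hbox i (Nat.le_of_lt_succ h)
        · subst h; exact ⟨hpos, hle⟩
      · rcases Nat.lt_or_eq_of_le (Nat.le_of_lt_succ hk) with h | h
        · exact hrg k h
        · subst h
          rw [hinv, hy']
          ring
  obtain ⟨hbox, -, hrg⟩ := key n le_rfl
  exact ⟨gs, hrg, fun j hj => hbox j hj⟩

/-- **THE TRANSFER, FINITE-LEVEL ESTIMATE.**  Run-wise floor −M at level γ₀ + `RunRemAtLevels β N ℓ ρ γ₀` (ℓ, ρ ≥ 0) ⟹ for every level `0 < δ ≤ γ₀` and every window: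
`−M − δ·Σ_{[k,n)} ℓ_j − Σ_{[k,n)} ρ_j ≤ Σ_{[k,n)} N_j` (deep run at level δ under the ceiling `|N_j| + ℓ_j γ₀ + ρ_j`; floor along it; remainder scale by scale). [folklore]
[cite: Balaban1987RG1, Thm 2 p.259 and Thm 3 p.264 with (0.20) p.256] -/
theorem windowFloor_at_level {β : HBeta} {N ℓ ρ : ℕ → ℝ} {γ₀ M : ℝ} (hfl : RunwiseFloor β γ₀ M) (hℓ : ∀ k, 0 ≤ ℓ k) (hρ : ∀ k, 0 ≤ ρ k)
    (hrem : RunRemAtLevels β N ℓ ρ γ₀) {δ : ℝ} (hδ : 0 < δ) (hδγ : δ ≤ γ₀) {k n : ℕ} (hkn : k ≤ n) :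
    -M - δ * ∑ j ∈ Ico k n, ℓ j - ∑ j ∈ Ico k n, ρ j ≤ ∑ j ∈ Ico k n, N j := by
  have hB0 : ∀ j, 0 ≤ |N j| + ℓ j * γ₀ + ρ j := fun j => by
    have := hℓ j; have := hρ j; have := abs_nonneg (N j); have : 0 ≤ γ₀ := hδ.le.trans hδγ
    positivity
  have hB : ∀ (j : ℕ) (gs : ℕ → ℝ), RGEqH j β gs → Step.InInterval δ j gs → β j (prefixOf gs j) ≤ |N j| + ℓ j * γ₀ + ρ j := by
    intro j gs hrg hI
    have h := hrem δ hδ hδγ j gs hrg hI j le_rfl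
    have h1 : β j (prefixOf gs j) ≤ N j + (ℓ j * δ + ρ j) := by linarith [(abs_le.mp h).2]
    have h2 : ℓ j * δ ≤ ℓ j * γ₀ := mul_le_mul_of_nonneg_left hδγ (hℓ j)
    linarith [le_abs_self (N j)]
  obtain ⟨gs, hrg, hI⟩ := deepRun_of_runUpper hδ hB0 hB n
  have hfloor := (hfl.mono hδγ) n gs hrg hI k hkn
  have hterm : ∀ j ∈ Ico k n, β j (prefixOf gs j) ≤ N j + (δ * ℓ j + ρ j) := by
    intro j hj
    have hjn : j ≤ n := (mem_Ico.mp hj).2.le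
    have h := hrem δ hδ hδγ n gs hrg hI j hjn
    linarith [(abs_le.mp h).2, mul_comm (ℓ j) δ]
  have hsum := Finset.sum_le_sum hterm
  rw [Finset.sum_add_distrib, Finset.sum_add_distrib, ← Finset.mul_sum] at hsum
  linarith

/-- **★ T8♭ IN RUN CURRENCY — THE TRANSFER THEOREM.**  Run-wise floor −M at SOME level γ₀ > 0 (K1⁹'s row (iv) shape) + a run remainder AT ALL LEVELS with δ-proportional part
`ℓ_k δ` and δ-free residual `ρ_k` ⟹ the remainder sequence is floored window by window up to the residual mass: `−M − Σ_{[k,n)} ρ_j ≤ Σ_{[k,n)} N_j`.  (δ → 0 in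
`windowFloor_at_level`.)  ANSWER to CRIT-2 ROUND 7: the floor transfers for g-PROPORTIONAL remainders (ρ ≡ 0: verbatim, any scale-dependent constants ℓ_k) and for SUMMABLE
residuals (up to −Σρ); NOT for a fixed radius (`fixedRadius_noTransfer`). CONDITIONAL on the displayed hypothesis shapes; nothing of Bałaban's β asserted.
[cite: Balaban1987RG1, Thm 2 p.259, Thm 3 p.264 with (0.20) p.256, §5 p.298] -/
theorem windowFloor_of_runwiseFloor_runRemAtLevels {β : HBeta} {N ℓ ρ : ℕ → ℝ} {γ₀ M : ℝ} (hγ₀ : 0 < γ₀) (hfl : RunwiseFloor β γ₀ M)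
    (hℓ : ∀ k, 0 ≤ ℓ k) (hρ : ∀ k, 0 ≤ ρ k) (hrem : RunRemAtLevels β N ℓ ρ γ₀) :
    ∀ k n : ℕ, k ≤ n → -M - ∑ j ∈ Ico k n, ρ j ≤ ∑ j ∈ Ico k n, N j := by
  intro k n hkn
  by_contra hlt
  have hlt := not_le.mp hlt
  set S : ℝ := ∑ j ∈ Ico k n, ℓ j with hS
  have hS0 : 0 ≤ S := Finset.sum_nonneg fun j _ => hℓ j
  set ε : ℝ := -M - ∑ j ∈ Ico k n, ρ j - ∑ j ∈ Ico k n, N j with hε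
  have hε0 : 0 < ε := by rw [hε]; linarith
  -- choose δ := min γ₀ (ε ∕ (2 (S + 1)))
  set δ : ℝ := min γ₀ (ε / (2 * (S + 1))) with hδdef
  have hδ0 : 0 < δ := lt_min hγ₀ (by positivity)
  have hδγ : δ ≤ γ₀ := min_le_left _ _
  have hest := windowFloor_at_level hfl hℓ hρ hrem hδ0 hδγ hkn
  have hδS : δ * S ≤ ε / 2 := by
    have h1 : δ ≤ ε / (2 * (S + 1)) := min_le_right _ _
    have h2 : δ * S ≤ ε / (2 * (S + 1)) * S := mul_le_mul_of_nonneg_right h1 hS0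
    have h3 : ε / (2 * (S + 1)) * S ≤ ε / 2 := by
      rw [div_mul_eq_mul_div, div_le_div_iff₀ (by positivity) (by positivity)]
      nlinarith
    linarith
  rw [← hS] at hest
  linarith

/-- **PROPORTIONAL RADIUS ⟹ THE FLOOR TRANSFERS VERBATIM** (ρ ≡ 0). [cite: Balaban1987RG1, Thm 2 p.259, Thm 3 p.264] -/
theorem windowFloor_of_runwiseFloor_propRadius {β : HBeta} {N ℓ : ℕ → ℝ} {γ₀ M : ℝ} (hγ₀ : 0 < γ₀) (hfl : RunwiseFloor β γ₀ M)
    (hℓ : ∀ k, 0 ≤ ℓ k) (hrem : RunRemAtLevels β N ℓ (fun _ => 0) γ₀) :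
    ∀ k n : ℕ, k ≤ n → -M ≤ ∑ j ∈ Ico k n, N j := by
  intro k n hkn
  have h := windowFloor_of_runwiseFloor_runRemAtLevels hγ₀ hfl hℓ (fun _ => le_rfl) hrem k n hkn
  simpa using h

/-- A CONSTANT sequence with window floors `−R ≤ (n−k)·c` for all windows is `≥ 0`. [folklore] -/
theorem const_nonneg_of_windowFloor {c R : ℝ} (h : ∀ k n : ℕ, k ≤ n → -R ≤ ∑ _j ∈ Ico k n, c) : 0 ≤ c := by
  by_contra hlt
  have hc : c < 0 := not_le.mp hlt
  obtain ⟨n, hn⟩ := exists_nat_gt ((R + 1) / (-c))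
  have h1 := h 0 n (Nat.zero_le n)
  simp only [Finset.sum_const, Nat.card_Ico, Nat.sub_zero, nsmul_eq_mul] at h1
  have h2 : (R + 1) / (-c) * (-c) < (n : ℝ) * (-c) := mul_lt_mul_of_pos_right hn (by linarith)
  rw [div_mul_cancel₀ _ (by linarith : (-c) ≠ 0)] at h2
  linarith

/-- **SUMMABLE RESIDUAL + CONSTANT REMAINDER ⟹ `0 ≤ c`**: if `N ≡ c` with `RunRemAtLevels β (·↦c) ℓ ρ γ₀`, `Σ_{[k,n)} ρ ≤ R` for all windows, and the run-wise floor holds at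
level γ₀, then `0 ≤ c` (the shape of bflow-p2 #70d's `bstar_nonneg_of_runPS`, here as an instance of the transfer). [cite: Balaban1987RG1, Thm 2 p.259, Thm 3 p.264, §5 p.298] -/
theorem const_nonneg_of_runwiseFloor_summable {β : HBeta} {ℓ ρ : ℕ → ℝ} {γ₀ M c R : ℝ} (hγ₀ : 0 < γ₀) (hfl : RunwiseFloor β γ₀ M)
    (hℓ : ∀ k, 0 ≤ ℓ k) (hρ : ∀ k, 0 ≤ ρ k) (hR : ∀ k n : ℕ, k ≤ n → ∑ j ∈ Ico k n, ρ j ≤ R)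
    (hrem : RunRemAtLevels β (fun _ => c) ℓ ρ γ₀) : 0 ≤ c := by
  refine const_nonneg_of_windowFloor (R := M + R) fun k n hkn => ?_
  have h := windowFloor_of_runwiseFloor_runRemAtLevels hγ₀ hfl hℓ hρ hrem k n hkn
  have h2 := hR k n hkn
  linarith

/-! ### §A.1 Instances: which located supplier roads pay the tax -/

section Instances

variable {β : HBeta} {γ : ℝ} {Λ : ℕ → ℕ → ℝ} {b : ℕ → ℝ}

/-- **(a) THE CORNER ROAD IS THE PROPORTIONAL INSTANCE, MASS-FREE.**  `HistLipschitz Λ γ β` (γ > 0) and a per-scale anchor `ScaleAnchor β b` (McShane: it exists by the moduli alone,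
dag-n24 #11 `exists_scaleAnchor_of_histLipschitz`) ⟹ `RunRemAtLevels β b (k ↦ Σ_i |Λ_{k,i}|) 0 γ` — N18's band `|β_k p − b_k| ≤ Σ_i |Λ_{k,i}| p_i` (`abs_sub_le_sum_of_anchor_of_histLipschitz`,
`abs_sub_le_mul_of_band` BY NAME) read along runs.  Scale-dependent ℓ_k, NO mass bound. [cite: Balaban1987RG1, Thm 3 p.264, (2.12)–(2.14) p.268] -/
theorem runRemAtLevels_of_histLipschitz_anchor (hL : HistLipschitz Λ γ β) (hb : ScaleAnchor β b) :
    RunRemAtLevels β b (fun k => ∑ i : Fin (k + 1), |Λ k i|) (fun _ => 0) γ := by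
  intro δ hδ hδγ n gs hrg hI k hk
  have hband := abs_sub_le_sum_of_anchor_of_histLipschitz hL hb
  have hp : prefixOf gs k ∈ B12Beta.HistBox δ k := fun i => by
    rw [prefixOf_apply]; exact hI i (by have := i.isLt; omega)
  have h := abs_sub_le_mul_of_band hband hδγ k hp
  show |β k (prefixOf gs k) - b k| ≤ (∑ i : Fin (k + 1), |Λ k i|) * δ + 0
  rw [add_zero]; exact h

/-- **… HENCE THE KERNEL's T8♭ IS THE PROPORTIONAL INSTANCE OF THE TRANSFER** (`Idea7V7cCornerNecessity.cornerFloor_of_histLipschitz_runwiseFloor`, re-derived through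
`windowFloor_of_runwiseFloor_propRadius`; same hypotheses, same conclusion): moduli + anchor + run-wise floor at some level ⟹ the anchor sequence is floored window by window.
CONDITIONAL on hypothesis shapes. [cite: Balaban1987RG1, Thm 2 p.259, Thm 3 p.264, §5 p.298] -/
theorem anchor_windowFloor_via_runCurrency {γ₀ M : ℝ} (hγ : 0 < γ) (hL : HistLipschitz Λ γ β) (hb : ScaleAnchor β b) (hγ₀ : 0 < γ₀)
    (hfl : RunwiseFloor β γ₀ M) : ∀ k n : ℕ, k ≤ n → -M ≤ ∑ j ∈ Ico k n, b j := by
  have hrem := (runRemAtLevels_of_histLipschitz_anchor hL hb).mono (min_le_left γ γ₀)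
  exact windowFloor_of_runwiseFloor_propRadius (lt_min hγ hγ₀) (hfl.mono (min_le_right γ γ₀))
    (fun k => Finset.sum_nonneg fun i _ => abs_nonneg _) hrem

/-- **(b) idea-5's S-LIN LETTER IS THE PROPORTIONAL INSTANCE WITH ℓ ≡ A** (`Idea5g13RunOnlyRoadSketch6.LinOnRuns13R` shape `|β_k(run prefix) − b_k| ≤ A·g_k`, spelled inline for an
abstract β, at all levels below γ₀ — it is level-monotone since `g_k ≤ δ` along a level-δ run): ⟹ `RunRemAtLevels β b (·↦A) 0 γ₀`, so the run-wise floor floors `b`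
(`windowFloor_of_runwiseFloor_propRadius`). [cite: Balaban1987RG1, Thm 3 p.264 with (0.20) p.256] -/
theorem runRemAtLevels_of_linOnRuns {A γ₀ : ℝ} (hA : 0 ≤ A)
    (hlin : ∀ (n : ℕ) (gs : ℕ → ℝ), RGEqH n β gs → Step.InInterval γ₀ n gs → ∀ k, k ≤ n → |β k (prefixOf gs k) - b k| ≤ A * gs k) :
    RunRemAtLevels β b (fun _ => A) (fun _ => 0) γ₀ := by
  intro δ hδ hδγ n gs hrg hI k hk
  have hIγ : Step.InInterval γ₀ n gs := fun i hi => ⟨(hI i hi).1, (hI i hi).2.trans hδγ⟩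
  have h := hlin n gs hrg hIγ k hk
  have h2 : A * gs k ≤ A * δ := mul_le_mul_of_nonneg_left (hI k hk).2 hA
  simpa using h.trans h2

/-- **(c) bflow-p2's NE4 SANDWICH IS THE SUMMABLE INSTANCE** (`…PointwiseFadingLimit.abs_beta_sub_bstar_le` BY NAME: under `HistLipschitz` + `FadingMemory C θ Λ` + `ScaleShiftRate c θ γ β`
and part 11's constant `b⋆`, `|β_k(v) − b⋆| ≤ 2Cδ∕(1−θ) + cθ^k∕(1−θ)` on every δ-box) ⟹ `RunRemAtLevels β (·↦b⋆) (·↦2C∕(1−θ)) (k↦cθ^k∕(1−θ)) γ`.  (Typed over the rate letters,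
presumptively dead at the record mod F-E — recorded here only to show #70d is an instance of the transfer.) [cite: Balaban1987RG1, Thm 3 p.264, §5 p.298] -/
theorem runRemAtLevels_of_moduli_NE4 {C c θ : ℝ} (hL : HistLipschitz Λ γ β) (hΛ : FadingMemory C θ Λ) (hS : ScaleShiftRate c θ γ β)
    (hθ0 : 0 ≤ θ) (hθ1 : θ < 1) (hC : 0 ≤ C) {bstar : ℝ}
    (hb : ∀ u : ℝ, 0 < u → u ≤ γ → |betaInf β (fun _ : ℕ => u) - bstar| ≤ C * u / (1 - θ)) :
    RunRemAtLevels β (fun _ => bstar) (fun _ => 2 * C / (1 - θ)) (fun k => c * θ ^ k / (1 - θ)) γ := by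
  intro δ hδ hδγ n gs hrg hI k hk
  have hv : prefixOf gs k ∈ Box δ k := prefixOf_mem_box_of_inInterval hI hk
  have h := abs_beta_sub_bstar_le hL hΛ hS hθ0 hθ1 hC hb hδ hδγ hv
  have h1θ : 0 < 1 - θ := by linarith
  calc |β k (prefixOf gs k) - bstar| ≤ 2 * C * δ / (1 - θ) + c * θ ^ k / (1 - θ) := h
    _ = 2 * C / (1 - θ) * δ + c * θ ^ k / (1 - θ) := by ring

/-- **… HENCE #70d's CONCLUSION `0 ≤ b⋆` BY A DIFFERENT ROUTE** (bflow-p2 `…FadingRunRowsNecessity.bstar_nonneg_of_runPS` re-derived as the summable instance of the transfer: the residual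
`cθ^k∕(1−θ)` has window sums `≤ c∕(1−θ)²`, `0 ≤ c` by `ScaleShiftRate` at u = u).  Same hypotheses as #70d. CONDITIONAL; typed over the rate letters (dead mod F-E).
[cite: Balaban1987RG1, Thm 2 p.259 with (0.20) p.256 and §5 p.298] -/
theorem bstar_nonneg_via_runCurrency {C c θ : ℝ} (hL : HistLipschitz Λ γ β) (hΛ : FadingMemory C θ Λ) (hS : ScaleShiftRate c θ γ β)
    (hθ0 : 0 ≤ θ) (hθ1 : θ < 1) (hC : 0 ≤ C) (hγ : 0 < γ) {bstar : ℝ}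
    (hb : ∀ u : ℝ, 0 < u → u ≤ γ → |betaInf β (fun _ : ℕ => u) - bstar| ≤ C * u / (1 - θ))
    {γ₀ M : ℝ} (hγ₀ : 0 < γ₀) (hfl : RunwiseFloor β γ₀ M) : 0 ≤ bstar := by
  have h1θ : 0 < 1 - θ := by linarith
  have hc : 0 ≤ c := T4BetaStationary.constant_nonneg_of_scaleShiftRate hS hγ
  have hrem := (runRemAtLevels_of_moduli_NE4 hL hΛ hS hθ0 hθ1 hC hb).mono (min_le_left γ γ₀)
  refine const_nonneg_of_runwiseFloor_summable (R := c / (1 - θ) ^ 2) (lt_min hγ hγ₀) (hfl.mono (min_le_right γ γ₀))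
    (fun _ => by positivity) (fun k => by positivity) (fun k n _ => ?_) hrem
  -- Σ_{[k,n)} cθ^j∕(1−θ) ≤ c∕(1−θ)²
  have hgeom : ∑ j ∈ Ico k n, θ ^ j ≤ 1 / (1 - θ) := by
    refine (geom_sum_Ico_le_of_lt_one hθ0 hθ1).trans ?_
    rw [div_le_div_iff_of_pos_right h1θ]
    exact pow_le_one₀ hθ0 hθ1.le
  calc ∑ j ∈ Ico k n, c * θ ^ j / (1 - θ) = c / (1 - θ) * ∑ j ∈ Ico k n, θ ^ j := by
        rw [Finset.mul_sum]; exact Finset.sum_congr rfl fun j _ => by ring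
    _ ≤ c / (1 - θ) * (1 / (1 - θ)) := mul_le_mul_of_nonneg_left hgeom (by positivity)
    _ = c / (1 - θ) ^ 2 := by rw [div_mul_div_comm, mul_one, ← sq]

end Instances

/-! ### §A.2 The no-go: a FIXED radius does not transfer — K1⁹'s rows text floors nothing about its own named `b` -/

/-- TOY `β ≡ 0` (the kernel's §3 TOY A, re-declared). A definition. -/
def betaZero : HBeta := fun _ _ => 0

/-- **★ NO TRANSFER FOR A FIXED RADIUS.**  For `β ≡ 0`, `b ≡ −r` (`r > 0`) and ANY level `γ₀ > 0`: K1⁹'s three rows hold WITH THIS `b` — (i) `RunConstRemainder β b r γ₀`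
(DEF-1's letter BY NAME), (iv) `RunwiseFloor β γ₀ 0`, (C) `SurvCont β γ₀` — while the window sums of `b` are `−r·n → −∞`.  So the run-wise floor does NOT pass to a remainder
sequence known only to fixed radius: T8♭ taxes the SUPPLIER ROADS (§A.1), not the crux text; K1⁹ BY NAME floors its own `b` only through an extra letter (kernel T9♭ʳⱽ:
`HistLipschitz`; or S-LIN, §A.1 (b)).  A TOY MODEL; nothing about Bałaban's β. [cite: Balaban1987RG1, Thm 2 p.259, Thm 3 p.264 with (0.20) p.256] -/
theorem fixedRadius_noTransfer {r γ₀ : ℝ} (hr : 0 < r) :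
    RunConstRemainder betaZero (fun _ => -r) r γ₀ ∧ RunwiseFloor betaZero γ₀ 0 ∧ SurvCont betaZero γ₀ ∧
      ∀ M : ℝ, ∃ n : ℕ, ∑ j ∈ Ico 0 n, (fun _ : ℕ => -r) j < -M := by
  refine ⟨fun n gs _ _ k _ => ?_, fun n gs _ _ k _ => ?_, fun k => ?_, fun M => ?_⟩
  · simp [betaZero, abs_of_pos hr]
  · simp [betaZero]
  · simp only [betaZero]; exact continuousOn_const
  · obtain ⟨n, hn⟩ := exists_nat_gt (M / r)
    refine ⟨n, ?_⟩
    have h : M < n * r := (div_lt_iff₀ hr).mp hn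
    simp only [Finset.sum_const, Nat.card_Ico, Nat.sub_zero, nsmul_eq_mul]
    linarith

/-- A fixed-radius run remainder at level γ₀ (DEF-1's `RunConstRemainder β N r γ₀`, K1⁹'s row (i) shape) IS the instance `ℓ ≡ 0, ρ ≡ r` of `RunRemAtLevels` (level-monotone). [folklore] -/
theorem runRemAtLevels_of_runConstRemainder {β : HBeta} {N : ℕ → ℝ} {r γ₀ : ℝ} (h : RunConstRemainder β N r γ₀) :
    RunRemAtLevels β N (fun _ => 0) (fun _ => r) γ₀ := by
  intro δ hδ hδγ n gs hrg hI k hk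
  have hIγ : Step.InInterval γ₀ n gs := fun i hi => ⟨(hI i hi).1, (hI i hi).2.trans hδγ⟩
  have h' := h n gs hrg hIγ k hk
  show |β k (prefixOf gs k) - N k| ≤ 0 * δ + r
  rw [zero_mul, zero_add]; exact h'

/-- **CRIT-2's BOUND IS THE FIXED-RADIUS INSTANCE, AND IT IS ALL ONE GETS**: rows (iv) + (i) with fixed radius r ⟹ only `−M − (n−k)·r ≤ Σ_{[k,n)} N_j` (transfer with ρ ≡ r);
`fixedRadius_noTransfer` shows no r-free floor follows. [cite: Balaban1987RG1, Thm 2 p.259, Thm 3 p.264 with (0.20) p.256] -/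
theorem weakFloor_of_runConstRemainder {β : HBeta} {N : ℕ → ℝ} {r γ₀ M : ℝ} (hγ₀ : 0 < γ₀) (hr : 0 ≤ r) (hfl : RunwiseFloor β γ₀ M)
    (h : RunConstRemainder β N r γ₀) : ∀ k n : ℕ, k ≤ n → -M - ((n : ℝ) - k) * r ≤ ∑ j ∈ Ico k n, N j := by
  intro k n hkn
  have h' : -M - ∑ _j ∈ Ico k n, r ≤ ∑ j ∈ Ico k n, N j :=
    windowFloor_of_runwiseFloor_runRemAtLevels hγ₀ hfl (fun _ => le_rfl) (fun _ => hr) (runRemAtLevels_of_runConstRemainder h) k n hkn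
  have hc : ∑ _j ∈ Ico k n, r = ((n : ℝ) - k) * r := by rw [Finset.sum_const, Nat.card_Ico, nsmul_eq_mul, Nat.cast_sub hkn]
  rw [hc] at h'; exact h'

/-! ## §B THE R-BM RE-CUT of bflow-p2's displayed-(0.31)-run road: ROW MASS instead of FADING MEMORY

Attribution: the road (one displayed lower-(0.31) run per depth ⟹ constant-history drift ⟹ crew CAP's carrier ⟹ rows) is b2b-balaban-beta-bflow-p2's (parts 10∕12, #70a∕#70b);
the currency swap FadingMemory ↦ bounded row mass is CRIT-2's R-BM (E-CRIT2-2) ∕ PORT-1's `U3LiteK`; new here: the fading letter is NOT load-bearing on that road, via the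
extremal profile below, with a smaller defect. -/

section Recut

variable {β : HBeta} {γ L δ s s' : ℝ} {Λ : ℕ → ℕ → ℝ}

/-- **THE EXTREMAL (0.31)-PROFILE** `u_i := (1∕γ² + s(K−i))^{-1∕2}`: the largest value the i-th coupling of a run of depth K inside ]0, γ] obeying the LOWER half of (0.31) at
slope s can take. A definition. [cite: Balaban1987RG1, (0.31) p.259] -/
def profile031 (γ s : ℝ) (K i : ℕ) : ℝ := 1 / Real.sqrt (1 / γ ^ 2 + s * ((K : ℝ) - i))

theorem profile031_radicand_pos (hγ : 0 < γ) (hs : 0 ≤ s) {K i : ℕ} (hi : i ≤ K) : 0 < 1 / γ ^ 2 + s * ((K : ℝ) - i) := by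
  have h1 : 0 < 1 / γ ^ 2 := by positivity
  have h2 : (0 : ℝ) ≤ (K : ℝ) - i := by
    have : (i : ℝ) ≤ K := Nat.cast_le.mpr hi
    linarith
  have h3 : 0 ≤ s * ((K : ℝ) - i) := mul_nonneg hs h2
  linarith

theorem profile031_pos (hγ : 0 < γ) (hs : 0 ≤ s) {K i : ℕ} (hi : i ≤ K) : 0 < profile031 γ s K i := by
  have := profile031_radicand_pos hγ hs hi
  unfold profile031; positivity

theorem inv_sq_profile031 (hγ : 0 < γ) (hs : 0 ≤ s) {K i : ℕ} (hi : i ≤ K) :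
    1 / (profile031 γ s K i) ^ 2 = 1 / γ ^ 2 + s * ((K : ℝ) - i) := by
  have hy := profile031_radicand_pos hγ hs hi
  unfold profile031
  rw [div_pow, one_pow, Real.sq_sqrt hy.le, one_div_one_div]

theorem profile031_last (hγ : 0 < γ) (s : ℝ) (K : ℕ) : profile031 γ s K K = γ := by
  have h : Real.sqrt (1 / γ ^ 2) = 1 / γ := by
    rw [show (1 : ℝ) / γ ^ 2 = (1 / γ) ^ 2 by ring]; exact Real.sqrt_sq (by positivity)
  simp only [profile031, sub_self, mul_zero, add_zero, h, one_div_one_div]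

/-- The profile increases with the scale index. [folklore] -/
theorem profile031_mono (hγ : 0 < γ) (hs : 0 ≤ s) {K i j : ℕ} (hij : i ≤ j) (hj : j ≤ K) : profile031 γ s K i ≤ profile031 γ s K j := by
  refine le_of_inv_sq_le (profile031_pos hγ hs (hij.trans hj)) (profile031_pos hγ hs hj) ?_
  rw [inv_sq_profile031 hγ hs hj, inv_sq_profile031 hγ hs (hij.trans hj)]
  have : (i : ℝ) ≤ j := Nat.cast_le.mpr hij
  nlinarith

/-- **EVERY RUN ENTRY IS MAJORISED BY THE PROFILE**: a run inside ]0, γ] with `Step.Discrete031 s s′ K (r_K) r` (s ≥ 0) has `r_i ≤ u_i` for all `i ≤ K`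
(`1∕r_i² ≥ 1∕r_K² + s(K−i) ≥ 1∕γ² + s(K−i)`). [cite: Balaban1987RG1, (0.31) p.259] -/
theorem run_le_profile031 (hγ : 0 < γ) (hs : 0 ≤ s) {K : ℕ} {r : ℕ → ℝ} (hI : Step.InInterval γ K r) (hD : Step.Discrete031 s s' K (r K) r)
    {i : ℕ} (hi : i ≤ K) : r i ≤ profile031 γ s K i := by
  have hri := (hI i hi).1
  have hrK := hI K le_rfl
  have hKγ : 1 / γ ^ 2 ≤ 1 / (r K) ^ 2 :=
    one_div_le_one_div_of_le (pow_pos hrK.1 2) (sq_le_sq' (by linarith [hrK.1, hrK.2]) hrK.2)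
  have h31 := (hD i hi).1
  refine le_of_inv_sq_le hri (profile031_pos hγ hs hi) ?_
  rw [inv_sq_profile031 hγ hs hi]
  linarith

/-- **ONE LATTICE, ONE WINDOW, ROW-MASS CURRENCY.**  `HistLipschitz Λ γ β` with row mass `≤ L`, `0 < δ ≤ γ`, and a run of (0.20) of depth K inside ]0, γ] with
`Step.Discrete031 s s′ K (r_K) r` (s > 0) ⟹ the CONSTANT-history window sums drift two-sidedly:
`s(K−k) − E ≤ Σ_{[k,K)} β_j(δ,…,δ) ≤ s′(K−k) + E`, `E = Lδ(K−k) + (2L∕√s)√(K−k)` — move the run to the constant history scale by scale at cost `L(u_j + δ)` (`abs_sub_le_rowMass`,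
`run_le_profile031`), and `Σ_{[k,K)} u ≤ 2√(K−k)∕√s` (bflow-p2 part 9b's `sum_run_le_of_discrete031` BY NAME applied to the profile, which satisfies (0.31) with equality).
NO fading memory. [cite: Balaban1987RG1, Thm 2 (0.31) p.259 with (0.20) p.256 and §5 p.298] -/
theorem constDrift_window_rowMass (hL : HistLipschitz Λ γ β) (hM : ∀ k, ∑ i : Fin (k + 1), |Λ k i| ≤ L) (hδ : 0 < δ) (hδγ : δ ≤ γ) (hs : 0 < s)
    {K : ℕ} {r : ℕ → ℝ} (hrg : RGEqH K β r) (hI : Step.InInterval γ K r) (hD : Step.Discrete031 s s' K (r K) r) {k : ℕ} (hk : k ≤ K) :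
    s * ((K : ℝ) - k) - (L * δ * ((K : ℝ) - k) + 2 * L / Real.sqrt s * Real.sqrt ((K : ℝ) - k)) ≤ ∑ j ∈ Ico k K, β j (fun _ : Fin (j + 1) => δ) ∧
      ∑ j ∈ Ico k K, β j (fun _ : Fin (j + 1) => δ) ≤ s' * ((K : ℝ) - k) + (L * δ * ((K : ℝ) - k) + 2 * L / Real.sqrt s * Real.sqrt ((K : ℝ) - k)) := by
  have hγ : 0 < γ := hδ.trans_le hδγ
  have hL0 : 0 ≤ L := rowMass_nonneg hM
  have htel := inv_sq_telescopeH hrg hk le_rfl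
  have h31 := hD k hk
  set u : ℕ → ℝ := profile031 γ s K with hu
  have hupos : ∀ i, i ≤ K → 0 < u i := fun i hi => profile031_pos hγ hs.le hi
  have hDu : Step.Discrete031 s s K (u K) u := by
    intro i hi
    rw [hu, profile031_last hγ s K, inv_sq_profile031 hγ hs.le hi]
    exact ⟨le_rfl, le_rfl⟩
  have hsumU : ∑ j ∈ Ico k K, u j ≤ 2 * Real.sqrt ((K : ℝ) - k) / Real.sqrt s := sum_run_le_of_discrete031 hs hupos hDu hk
  have hterm : ∀ j ∈ Ico k K, |β j (prefixOf r j) - β j (fun _ : Fin (j + 1) => δ)| ≤ L * (u j + δ) := by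
    intro j hj
    have hjK : j ≤ K := (mem_Ico.mp hj).2.le
    have hp : prefixOf r j ∈ Box γ j := prefixOf_mem_box_of_inInterval hI hjK
    have hq : (fun _ : Fin (j + 1) => δ) ∈ Box γ j := mem_box.mpr fun _ => ⟨hδ, hδγ⟩
    have huj := hupos j hjK
    refine abs_sub_le_rowMass hL hM hp hq (by linarith) fun i => ?_
    rw [prefixOf_apply]
    have hiK : (i : ℕ) ≤ K := by have := i.isLt; omega
    have hij : (i : ℕ) ≤ j := Nat.le_of_lt_succ i.isLt
    have hri := hI i hiK
    have h1 : r i ≤ u i := run_le_profile031 hγ hs.le hI hD hiK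
    have h2 : u i ≤ u j := profile031_mono hγ hs.le hij hjK
    rw [abs_sub_le_iff]; constructor <;> linarith [hri.1]
  have hdiff : |∑ j ∈ Ico k K, β j (prefixOf r j) - ∑ j ∈ Ico k K, β j (fun _ : Fin (j + 1) => δ)| ≤ ∑ j ∈ Ico k K, L * (u j + δ) := by
    rw [← Finset.sum_sub_distrib]
    exact (Finset.abs_sum_le_sum_abs _ _).trans (Finset.sum_le_sum hterm)
  have hcard : ((#(Ico k K) : ℕ) : ℝ) = (K : ℝ) - k := by rw [Nat.card_Ico, Nat.cast_sub hk]
  have hE : ∑ j ∈ Ico k K, L * (u j + δ) ≤ L * δ * ((K : ℝ) - k) + 2 * L / Real.sqrt s * Real.sqrt ((K : ℝ) - k) := by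
    have e : ∑ j ∈ Ico k K, L * (u j + δ) = L * ∑ j ∈ Ico k K, u j + L * δ * ((K : ℝ) - k) := by
      calc ∑ j ∈ Ico k K, L * (u j + δ) = ∑ j ∈ Ico k K, (L * u j + L * δ) := Finset.sum_congr rfl fun j _ => by ring
        _ = L * ∑ j ∈ Ico k K, u j + #(Ico k K) • (L * δ) := by rw [Finset.sum_add_distrib, Finset.mul_sum, Finset.sum_const]
        _ = L * ∑ j ∈ Ico k K, u j + L * δ * ((K : ℝ) - k) := by rw [nsmul_eq_mul, hcard]; ring
    rw [e]
    have h1 : L * ∑ j ∈ Ico k K, u j ≤ L * (2 * Real.sqrt ((K : ℝ) - k) / Real.sqrt s) := mul_le_mul_of_nonneg_left hsumU hL0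
    have h2 : L * (2 * Real.sqrt ((K : ℝ) - k) / Real.sqrt s) = 2 * L / Real.sqrt s * Real.sqrt ((K : ℝ) - k) := by ring
    linarith
  obtain ⟨hd1, hd2⟩ := abs_sub_le_iff.mp hdiff
  constructor <;> linarith [h31.1, h31.2]

/-- **ALL WINDOWS**: with a displayed (0.31)-run for EVERY depth, the constant-history windows `[k, k+N)` obey
`sN − (LδN + (2L∕√s)√N) ≤ Σ β_j(δ̄) ≤ s′N + (LδN + (2L∕√s)√N)` (the run of depth k+N). [cite: Balaban1987RG1, Thm 2 (0.31) p.259 with (0.20) p.256] -/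
theorem constDrift_of_runs_rowMass (hL : HistLipschitz Λ γ β) (hM : ∀ k, ∑ i : Fin (k + 1), |Λ k i| ≤ L) (hδ : 0 < δ) (hδγ : δ ≤ γ) (hs : 0 < s)
    (hruns : ∀ K : ℕ, ∃ r : ℕ → ℝ, RGEqH K β r ∧ Step.InInterval γ K r ∧ Step.Discrete031 s s' K (r K) r) (k N : ℕ) :
    s * N - (L * δ * N + 2 * L / Real.sqrt s * Real.sqrt N) ≤ ∑ j ∈ Ico k (k + N), β j (fun _ : Fin (j + 1) => δ) ∧
      ∑ j ∈ Ico k (k + N), β j (fun _ : Fin (j + 1) => δ) ≤ s' * N + (L * δ * N + 2 * L / Real.sqrt s * Real.sqrt N) := by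
  obtain ⟨r, hrg, hI, hD⟩ := hruns (k + N)
  have h := constDrift_window_rowMass hL hM hδ hδγ hs hrg hI hD (Nat.le_add_right k N)
  have hcast : (((k + N : ℕ) : ℝ) - k) = (N : ℝ) := by push_cast; ring
  rw [hcast] at h
  exact h

/-- **★ crew CAP's AVERAGED-AF CARRIER FROM THE DISPLAYED (0.31)-RUN FAMILY IN ROW-MASS CURRENCY — NO FADING MEMORY, NO NE4.**  `HistLipschitz Λ γ β` with row mass `≤ L`, a run of
(0.20) inside ]0, γ] obeying `Step.Discrete031 s s′ K (r_K) r` for EVERY depth K (s > 0), and a box `0 < δ ≤ γ` with `4Lδ ≤ s` ⟹ `BetaAvgAFH (s∕4) (4L²∕s²) δ β`: along EVERY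
]0, δ]-history every window sum is `≥ (s∕4)(n−k) − 4L²∕s²`.  (Each term is within `Lδ ≤ s∕4` of the constant-history value; `constDrift_of_runs_rowMass`; `(2L∕√s)√N ≤ (s∕4)N + 4L²∕s²`
by `sqrt_absorb`.)  Compare part 10's `betaAvgAFH_of_runs_fadingMemory`: there `L = C∕(1−θ)` and an extra defect `Cγθ∕(1−θ)²` from fading out the pre-window history; here the
pre-window history is handled by the profile, so the fading letter drops out.  CONDITIONAL on the displayed hypotheses; nothing of Bałaban's β asserted.
[cite: Balaban1987RG1, Thm 2 (0.31) p.259 with (0.20) p.256, Thm 3 p.264, §5 p.298] -/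
theorem betaAvgAFH_of_runs_rowMass (hL : HistLipschitz Λ γ β) (hM : ∀ k, ∑ i : Fin (k + 1), |Λ k i| ≤ L) (hδ : 0 < δ) (hδγ : δ ≤ γ) (hs : 0 < s)
    (hsmall : 4 * L * δ ≤ s) (hruns : ∀ K : ℕ, ∃ r : ℕ → ℝ, RGEqH K β r ∧ Step.InInterval γ K r ∧ Step.Discrete031 s s' K (r K) r) :
    BetaAvgAFH (s / 4) (4 * L ^ 2 / s ^ 2) δ β := by
  intro v hv k n hkn
  have hL0 : 0 ≤ L := rowMass_nonneg hM
  obtain ⟨N, rfl⟩ : ∃ N, n = k + N := ⟨n - k, by omega⟩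
  have hcast : (((k + N : ℕ) : ℝ) - k) = (N : ℝ) := by push_cast; ring
  rw [hcast]
  obtain ⟨hlo, -⟩ := constDrift_of_runs_rowMass hL hM hδ hδγ hs hruns k N
  have hterm : ∀ j ∈ Ico k (k + N), β j (fun _ : Fin (j + 1) => δ) - L * δ ≤ β j (prefixOf v j) := by
    intro j _
    have hp : prefixOf v j ∈ Box γ j := mem_box.mpr fun i => by rw [prefixOf_apply]; exact ⟨(hv i).1, (hv i).2.trans hδγ⟩
    have hq : (fun _ : Fin (j + 1) => δ) ∈ Box γ j := mem_box.mpr fun _ => ⟨hδ, hδγ⟩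
    have h := abs_sub_le_rowMass hL hM hp hq hδ.le fun i => by
      rw [prefixOf_apply, abs_sub_le_iff]; constructor <;> linarith [(hv i).1, (hv i).2]
    linarith [(abs_le.mp h).1]
  have hsum := Finset.sum_le_sum hterm
  rw [Finset.sum_sub_distrib, Finset.sum_const, Nat.card_Ico, nsmul_eq_mul, Nat.add_sub_cancel_left] at hsum
  have hab := sqrt_absorb (A := 2 * L / Real.sqrt s) hs N
  have hA : (2 * L / Real.sqrt s) ^ 2 / s = 4 * L ^ 2 / s ^ 2 := by
    rw [div_pow, Real.sq_sqrt hs.le]; ring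
  rw [hA] at hab
  have hN0 : (0 : ℝ) ≤ N := Nat.cast_nonneg N
  have h4 : L * δ * N ≤ s / 4 * N := mul_le_mul_of_nonneg_right (by linarith) hN0
  have h4' : (N : ℝ) * (L * δ) ≤ s / 4 * N := by linarith
  linarith

/-- **bflow-p2 part 10 RE-DERIVED WITH A SMALLER DEFECT** (`FadingMemory C θ Λ` IS a row-mass bound `L = C∕(1−θ)`): the same hypotheses as `betaAvgAFH_of_runs_fadingMemory` give
`BetaAvgAFH (s∕4) (4C²∕((1−θ)²s²)) δ β` — WITHOUT the `Cγθ∕(1−θ)²` term. [cite: Balaban1987RG1, Thm 2 (0.31) p.259 with (0.20) p.256 and §5 p.298] -/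
theorem betaAvgAFH_of_runs_fadingMemory_sharper {C θ : ℝ} (hL : HistLipschitz Λ γ β) (hΛ : FadingMemory C θ Λ) (hθ0 : 0 ≤ θ) (hθ1 : θ < 1) (hC : 0 ≤ C)
    (hδ : 0 < δ) (hδγ : δ ≤ γ) (hs : 0 < s) (hsmall : 4 * C * δ ≤ s * (1 - θ))
    (hruns : ∀ K : ℕ, ∃ r : ℕ → ℝ, RGEqH K β r ∧ Step.InInterval γ K r ∧ Step.Discrete031 s s' K (r K) r) :
    BetaAvgAFH (s / 4) (4 * C ^ 2 / ((1 - θ) ^ 2 * s ^ 2)) δ β := by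
  have h1θ : 0 < 1 - θ := by linarith
  have hM := rowMass_of_fadingMemory hθ0 hθ1 hC hΛ
  have hsmall' : 4 * (C / (1 - θ)) * δ ≤ s := by
    rw [show 4 * (C / (1 - θ)) * δ = 4 * C * δ / (1 - θ) by ring, div_le_iff₀ h1θ]; exact hsmall
  have h := betaAvgAFH_of_runs_rowMass hL hM hδ hδγ hs hsmall' hruns
  have e : 4 * (C / (1 - θ)) ^ 2 / s ^ 2 = 4 * C ^ 2 / ((1 - θ) ^ 2 * s ^ 2) := by
    rw [div_pow]; field_simp
  rw [e] at h; exact h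

/-- … and part 10's LITERAL statement back (weakening the defect). [cite: Balaban1987RG1, Thm 2 (0.31) p.259 with (0.20) p.256 and §5 p.298] -/
theorem betaAvgAFH_of_runs_fadingMemory_literal {C θ : ℝ} (hL : HistLipschitz Λ γ β) (hΛ : FadingMemory C θ Λ) (hθ0 : 0 ≤ θ) (hθ1 : θ < 1) (hC : 0 ≤ C)
    (hδ : 0 < δ) (hδγ : δ ≤ γ) (hs : 0 < s) (hsmall : 4 * C * δ ≤ s * (1 - θ))
    (hruns : ∀ K : ℕ, ∃ r : ℕ → ℝ, RGEqH K β r ∧ Step.InInterval γ K r ∧ Step.Discrete031 s s' K (r K) r) :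
    BetaAvgAFH (s / 4) (4 * C ^ 2 / ((1 - θ) ^ 2 * s ^ 2) + C * γ * θ / (1 - θ) ^ 2) δ β := by
  have hγ : 0 ≤ γ := hδ.le.trans hδγ
  exact (betaAvgAFH_of_runs_fadingMemory_sharper hL hΛ hθ0 hθ1 hC hδ hδγ hs hsmall hruns).of_le le_rfl (le_add_of_nonneg_right (by positivity))

/-- **ROW (i) IN ROW-MASS CURRENCY**: along every in-window solution of (0.20) inside ]0, γ₀] (`γ₀ ≤ γ`), `|β_k(g_0..g_k) − β_k(γ₀,…,γ₀)| ≤ L·γ₀` — radius PROPORTIONAL to the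
level, remainder sequence `b_k := β_k(γ₀̄)` LEVEL-INDEXED (so §A's transfer applies only level by level; on this road the floor question is moot: `constDrift_of_runs_rowMass` drifts
`b` UPWARD linearly). [cite: Balaban1987RG1, Thm 3 p.264 with (0.20) p.256] -/
theorem runRem_constHist_of_rowMass (hL : HistLipschitz Λ γ β) (hM : ∀ k, ∑ i : Fin (k + 1), |Λ k i| ≤ L) {γ₀ : ℝ} (hγ₀ : 0 < γ₀) (hγ₀γ : γ₀ ≤ γ) :
    ∀ (n : ℕ) (gs : ℕ → ℝ), RGEqH n β gs → Step.InInterval γ₀ n gs →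
      ∀ k, k ≤ n → |β k (prefixOf gs k) - β k (fun _ : Fin (k + 1) => γ₀)| ≤ L * γ₀ := by
  intro n gs _ hI k hk
  have hp : prefixOf gs k ∈ Box γ k := prefixOf_mem_box_of_inInterval (fun i hi => ⟨(hI i hi).1, (hI i hi).2.trans hγ₀γ⟩) hk
  have hq : (fun _ : Fin (k + 1) => γ₀) ∈ Box γ k := mem_box.mpr fun _ => ⟨hγ₀, hγ₀γ⟩
  exact abs_sub_le_rowMass hL hM hp hq hγ₀.le fun i => by
    rw [prefixOf_apply, abs_sub_le_iff]
    have := hI i (by have := i.isLt; omega)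
    constructor <;> linarith [this.1, this.2]

/-- **★ THE ROWS TRIPLE IN ROW-MASS CURRENCY — bflow-p2's (α) `rowsTriple_of_runs_moduli` WITHOUT FADING MEMORY.**  `HistLipschitz Λ γ β` with row mass `≤ L` (γ > 0) + the displayed
(0.31)-run family at slope s > 0 ⟹ `∃ b r γ₀ M, 0 < γ₀ ≤ γ ∧ (i) ∧ (iv) ∧ (C)` in the exact inline shape of DEF-1's `RunRowsCont13`: `γ₀ = min γ (s∕(4(L+1)))`, `b_k = β_k(γ₀̄)`,
`r = Lγ₀`, `M = 4L²∕s²` (`betaAvgAFH_of_runs_rowMass` ⟶ `.partialSums` ⟶ pub-balaban-gaps' `runwisePS_of_betaPartialSumsLowerH`), (C) = part 12's `survCont_of_moduli` BY NAME.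
ANCHOR-FREE, JET-FREE, DRIFT-FREE, CAP-FREE, NE4-FREE, FADING-FREE.  CONDITIONAL on the displayed hypotheses; nothing of Bałaban's β asserted.
[cite: Balaban1987RG1, Thm 2 (0.31) p.259, Thm 3 p.264, §1 pp.263–264, (5.10) p.293, §5 p.298] -/
theorem rowsTriple_of_runs_rowMass (hL : HistLipschitz Λ γ β) (hM : ∀ k, ∑ i : Fin (k + 1), |Λ k i| ≤ L) (hγ : 0 < γ) (hs : 0 < s)
    (hruns : ∀ K : ℕ, ∃ r : ℕ → ℝ, RGEqH K β r ∧ Step.InInterval γ K r ∧ Step.Discrete031 s s' K (r K) r) :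
    ∃ (b : ℕ → ℝ) (r γ₀ M : ℝ), 0 < γ₀ ∧ γ₀ ≤ γ ∧
      (∀ (n : ℕ) (gs : ℕ → ℝ), RGEqH n β gs → Step.InInterval γ₀ n gs → ∀ k, k ≤ n → |β k (prefixOf gs k) - b k| ≤ r) ∧
      (∀ (n : ℕ) (gs : ℕ → ℝ), RGEqH n β gs → Step.InInterval γ₀ n gs →
        ∀ k, k ≤ n → -M ≤ ∑ j ∈ Ico k n, β j (prefixOf gs j)) ∧
      ∀ k : ℕ, ContinuousOn (fun x : ℝ => β k (clampPrefix β γ₀ k x))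
        {x : ℝ | 0 < x ∧ x ≤ γ₀ ∧ ∀ j, j ≤ k → 1 / γ₀ ^ 2 ≤ Y β γ₀ j x} := by
  have hL0 : 0 ≤ L := rowMass_nonneg hM
  set γ₀ : ℝ := min γ (s / (4 * (L + 1))) with hγ₀def
  have hγ₀ : 0 < γ₀ := lt_min hγ (by positivity)
  have hγ₀γ : γ₀ ≤ γ := min_le_left _ _
  have hsmall : 4 * L * γ₀ ≤ s := by
    have h1 : γ₀ ≤ s / (4 * (L + 1)) := min_le_right _ _
    have h2 : γ₀ * (4 * (L + 1)) ≤ s := (le_div_iff₀ (by positivity)).mp h1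
    nlinarith [hγ₀.le]
  refine ⟨fun k => β k (fun _ => γ₀), L * γ₀, γ₀, 4 * L ^ 2 / s ^ 2, hγ₀, hγ₀γ, runRem_constHist_of_rowMass hL hM hγ₀ hγ₀γ, ?_,
    survCont_of_moduli hL hγ₀ hγ₀γ⟩
  have hps := (betaAvgAFH_of_runs_rowMass hL hM hγ₀ hγ₀γ hs hsmall hruns).partialSums (by positivity)
  exact runwisePS_of_betaPartialSumsLowerH hγ₀ hps

/-- **THE (α♭) SUPPLIER PAYS T8♭'s TAX ON ITS OWN `b`** (consistency with §A): under `betaAvgAFH_of_runs_rowMass`'s hypotheses the remainder sequence `b_k := β_k(δ,…,δ)` of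
`rowsTriple_of_runs_rowMass` has every window sum `≥ (s∕4)(n−k) − 4L²∕s² ≥ −4L²∕s²` (the carrier at the constant history δ itself) — it drifts UPWARD, as asymptotic freedom wants.
[cite: Balaban1987RG1, Thm 2 (0.31) p.259 with (0.20) p.256] -/
theorem constHist_windowFloor_of_runs_rowMass (hL : HistLipschitz Λ γ β) (hM : ∀ k, ∑ i : Fin (k + 1), |Λ k i| ≤ L) (hδ : 0 < δ) (hδγ : δ ≤ γ) (hs : 0 < s)
    (hsmall : 4 * L * δ ≤ s) (hruns : ∀ K : ℕ, ∃ r : ℕ → ℝ, RGEqH K β r ∧ Step.InInterval γ K r ∧ Step.Discrete031 s s' K (r K) r) :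
    ∀ k n : ℕ, k ≤ n → s / 4 * ((n : ℝ) - k) - 4 * L ^ 2 / s ^ 2 ≤ ∑ j ∈ Ico k n, β j (fun _ : Fin (j + 1) => δ) := by
  intro k n hkn
  have h := betaAvgAFH_of_runs_rowMass hL hM hδ hδγ hs hsmall hruns (fun _ => δ) (fun _ => ⟨hδ, le_rfl⟩) k n hkn
  have e : ∀ j, prefixOf (fun _ : ℕ => δ) j = fun _ : Fin (j + 1) => δ := fun j => funext fun i => by rw [prefixOf_apply]
  simpa only [e] using h

end Recut

/-! ### §B.1 Keyed to the route: DEF-1's `RunRowsCont13` ∕ `RowsContAll`, K2⁷ (aside) and K1⁸ BY NAME; K1⁹ via DEF-1's door (cited) -/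

section Keyed

variable {F : T4Family}

/-- **THE ROW-MASS ROAD AT THE TUPLE ⟹ DEF-1's `RunRowsCont13 F θ`** (#70b's `runRowsCont13_of_moduli_runs` with `FadingMemory` replaced by a row-mass bound; read through
`runRowsCont13_iff_inline`).  CONDITIONAL on the displayed letters (inhabited at no θ here); nothing of Bałaban's β asserted.
[cite: Balaban1987RG1, Thm 2 (0.31) p.259, Thm 3 p.264, §1 pp.263–264, (5.10) p.293, §5 p.298] -/
theorem runRowsCont13_of_rowMass_runs (θ : Node00.Stage13HParams F 2) {γ L s s' : ℝ} {Λ : ℕ → ℕ → ℝ}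
    (hL : HistLipschitz Λ γ (Node00.betaOfRecord₁₃ F 2 θ.toStage13Params)) (hM : ∀ k, ∑ i : Fin (k + 1), |Λ k i| ≤ L) (hγ : 0 < γ) (hs : 0 < s)
    (hruns : ∀ K : ℕ, ∃ r : ℕ → ℝ, RGEqH K (Node00.betaOfRecord₁₃ F 2 θ.toStage13Params) r ∧ Step.InInterval γ K r ∧
      Step.Discrete031 s s' K (r K) r) :
    RunRowsCont13 F θ := by
  obtain ⟨b, r, γ₀, M, hγ₀, -, hi, hiv, hC⟩ := rowsTriple_of_runs_rowMass hL hM hγ hs hruns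
  exact (runRowsCont13_iff_inline F θ).mpr ⟨b, r, γ₀, M, hγ₀, hi, hiv, hC⟩

/-- **THE AS-PRINTED INTERFACE AT THE TUPLE + U3ᴷ-lite ⟹ THE ROWS, FADING-FREE** (#70b §2's `runRowsCont13_of_typedTheorem2` with node U2's `FadingMemory` replaced by a row-mass bound):
`Theorem2Statement S hL` AS TYPED (a HYPOTHESIS, unproved in print) + prover 1's binder `hrg` on ]0, γ_U] + `HistLipschitz Λ γ_U S.β` with `Σ_i |Λ_{k,i}| ≤ L` ⟹ `RunRowsCont13 F θ`
(`runs_of_theorem2` BY NAME ⟶ `rowsTriple_of_runs_rowMass`).  READING: K1⁹'s rows conjunct ≤ «[I] Thm 2 AS TYPED at one endpoint + `hrg` + U3ᴷ-lite» — BN-N-free mod F-E.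
CONDITIONAL; nothing of Bałaban's β asserted. [cite: Balaban1987RG1, Thm 2 (0.31) p.259, Thm 3 p.264, §1 pp.263–264, (5.10) p.293, §5 p.298] -/
theorem runRowsCont13_of_typedTheorem2_rowMass (θ : Node00.Stage13HParams F 2) (S : Setting)
    (hSβ : S.β = Node00.betaOfRecord₁₃ F 2 θ.toStage13Params) {hL : Odd S.L ∧ 1 < S.L} (hT : Theorem2Statement S hL)
    {γU L : ℝ} {Λ : ℕ → ℕ → ℝ} (hγU : 0 < γU)
    (hrg : ∀ P : B12.RunParams, Step.InInterval γU P.K (S.cpl P) → RGEqH P.K S.β (S.cpl P))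
    (hLip : HistLipschitz Λ γU S.β) (hM : ∀ k, ∑ i : Fin (k + 1), |Λ k i| ≤ L) :
    RunRowsCont13 F θ := by
  obtain ⟨s, s', hs, -, hruns⟩ := runs_of_theorem2 hT hγU hrg
  have h := rowsTriple_of_runs_rowMass hLip hM hγU hs hruns
  rw [hSβ] at h
  obtain ⟨b, r, γ₀, M, hγ₀, -, h'⟩ := h
  exact (runRowsCont13_iff_inline F θ).mpr ⟨b, r, γ₀, M, hγ₀, h'⟩

/-- HYPOTHESIS SHAPE (never a fact): **THE ROW-MASS ROAD AT EVERY ADMISSIBLE TUPLE WITH PROVISOS** — the ∀θ letter of the programme (#70b §3's displayed letter with `FadingMemory`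
replaced by a row-mass bound).  DISPLAYED, NOT printed, inhabited nowhere here. [cite: Balaban1987RG1, Thm 2 (0.31) p.259, Thm 3 p.264, §5 p.298] -/
def RowMassRunsAll : Prop :=
  ∀ (F : T4Family) (θ : Node00.Stage13HParams F 2), θ.Provisos₁₃SepCoPH F 2 → θ.Admissible F 2 →
    ∃ (γ L s s' : ℝ) (Λ : ℕ → ℕ → ℝ), HistLipschitz Λ γ (Node00.betaOfRecord₁₃ F 2 θ.toStage13Params) ∧ (∀ k, ∑ i : Fin (k + 1), |Λ k i| ≤ L) ∧
      0 < γ ∧ 0 < s ∧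
      ∀ K : ℕ, ∃ r : ℕ → ℝ, RGEqH K (Node00.betaOfRecord₁₃ F 2 θ.toStage13Params) r ∧ Step.InInterval γ K r ∧ Step.Discrete031 s s' K (r K) r

/-- **THE ∀θ ROW-MASS LETTER ⟹ DEF-1's SUPPLIER PROGRAMME `RowsContAll`** (`rowsContAll_of_adm` BY NAME). CONDITIONAL. [cite: Balaban1987RG1, Thm 2 (0.31) p.259, Thm 3 p.264, §5 p.298] -/
theorem rowsContAll_of_rowMassRunsAll (h : RowMassRunsAll) : RowsContAll :=
  rowsContAll_of_adm fun F θ hP hθ => by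
    obtain ⟨γ, L, s, s', Λ, hL, hM, hγ, hs, hruns⟩ := h F θ hP hθ
    exact runRowsCont13_of_rowMass_runs θ hL hM hγ hs hruns

/-- … hence THE CARRIER's ASIDE DECL K2⁷ `…Theses.BalabanUVNodes.EndpointGivenBR13SepCoPH` (stmt-QuantumFields-20543) BY NAME (DEF-1's `endpointGivenBR13SepCoPH_of_rowsContAll`).
CONDITIONAL on the displayed ∀θ letter; K2⁷ NOT closed. [cite: Balaban1987RG1, Thm 2 p.259 (first sentence), Thm 3 p.264, (5.10) p.293] -/
theorem endpointGivenBR13SepCoPH_of_rowMassRunsAll (h : RowMassRunsAll) : EndpointGivenBR13SepCoPH :=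
  endpointGivenBR13SepCoPH_of_rowsContAll (rowsContAll_of_rowMassRunsAll h)

/-- … and K1⁸ `…Theses.BalabanUVNodes.StabilityBRunRowsAtRecordR13SepCoPH` (aside 26907) FROM THE ASIDE DECL K1⁷ + the ∀θ row-mass letter BY NAME (DEF-1's
`stabilityBRunRowsAtRecordR13SepCoPH_of_k17_rowsContAll`); the DECIDING K1⁹ (27364) `…StabilityBRunRowsAtRecordR13SepCoPHV` then follows by DEF-1's door
`…K1R9VersionSlotDefs.stabilityBRunRowsAtRecordR13SepCoPHV_of_k1R8` (p624736) BY NAME — cited, not imported (that module lagged on the farm at check time).  CONDITIONAL on both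
displayed texts; K1⁸ ∕ K1⁹ NOT closed; counts unmoved. [cite: Balaban1989LargeFieldII, Thm 1 p.355; Balaban1987RG1, Thm 3 p.264, (5.10) p.293, §1 pp.263–264] -/
theorem stabilityBRunRowsAtRecordR13SepCoPH_of_k17_rowMassRunsAll (h1 : StabilityBAtRecordR13SepCoPH) (h : RowMassRunsAll) :
    StabilityBRunRowsAtRecordR13SepCoPH :=
  stabilityBRunRowsAtRecordR13SepCoPH_of_k17_rowsContAll h1 (rowsContAll_of_rowMassRunsAll h)

/-- **★ (ED.2) THE DECIDING CRUX DECL BY NAME.** K1⁹ = stmt-QuantumFields-27364 `…Theses.BalabanUVNodes.StabilityBRunRowsAtRecordR13SepCoPHV` (K1⁸ + DEF-1's version slot `v`, rows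
slot-free) FROM the aside decl K1⁷ (`StabilityBAtRecordR13SepCoPH`, stmt-20542) + the ∀θ (α♭) letter `RowMassRunsAll` (U3ᴷ-lite currency: moduli + row mass, and [I] Thm 2's lower (0.31)
along ONE run per depth) — via K1⁸ (`stabilityBRunRowsAtRecordR13SepCoPH_of_k17_rowMassRunsAll`) and DEF-1's door `stabilityBRunRowsAtRecordR13SepCoPHV_of_k1R8` (p624736, `v := .refl`)
now IMPORTED.  2ᶜᴰ-free, N17-free, fading-free.  CONDITIONAL on both hypothesis texts (inhabited at no θ here); 27364 NOT closed; counts unmoved; nothing of Bałaban asserted.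
[cite: Balaban1989LargeFieldII, Thm 1 p.355; Balaban1987RG1, Thm 2 (0.31) p.259, Thm 3 p.264, (2.12)–(2.14) p.268, (5.10) p.293] -/
theorem stabilityBRunRowsAtRecordR13SepCoPHV_of_k17_rowMassRunsAll (h1 : StabilityBAtRecordR13SepCoPH) (h : RowMassRunsAll) :
    Summit.QuantumFields.YangMills.Theses.BalabanUVNodes.StabilityBRunRowsAtRecordR13SepCoPHV :=
  Summit.QuantumFields.YangMills.Theorems.BalabanUVNodesK1R9VersionSlotDefs.stabilityBRunRowsAtRecordR13SepCoPHV_of_k1R8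
    (stabilityBRunRowsAtRecordR13SepCoPH_of_k17_rowMassRunsAll h1 h)

end Keyed

/-! ## §C PRICE ∕ SEPARATION of the (α♭) input (the displayed lower-(0.31) run family) -/

section Price

variable {β : HBeta} {γ s s' : ℝ}

/-- **THE HIDDEN POINTWISE SIGN DATUM**: a run of (0.20) of depth `K ≥ 1` with `Step.Discrete031 s s′ K (r_K) r` has `s ≤ β_{K−1}(r_0,…,r_{K−1})` (last step of the telescope
against (0.31) at k = K−1).  So `hruns` carries, for every K, ONE history of length K inside the box on which β is `≥ s > 0` — a pointwise AF datum at arbitrarily deep scales,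
which NO corner-currency letter (anchor ∕ drift ∕ rows) supplies (`no_run031_betaAlt`). [cite: Balaban1987RG1, (0.31) p.259 with (0.20) p.256] -/
theorem topStep_lower_of_discrete031 {K : ℕ} {r : ℕ → ℝ} (hK : 1 ≤ K) (hrg : RGEqH K β r) (hD : Step.Discrete031 s s' K (r K) r) :
    s ≤ β (K - 1) (prefixOf r (K - 1)) := by
  have hk : K - 1 ≤ K := Nat.sub_le K 1
  have htel := inv_sq_telescopeH hrg hk le_rfl
  have h31 := (hD (K - 1) hk).1
  have hIco : Ico (K - 1) K = {K - 1} := by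
    rw [← Nat.Ico_succ_singleton]; congr 1; omega
  have hcast : ((K : ℝ) - ((K - 1 : ℕ) : ℝ)) = 1 := by
    rw [Nat.cast_sub hK]; push_cast; ring
  rw [hcast, mul_one] at h31
  rw [hIco, Finset.sum_singleton] at htel
  linarith

/-- TOY ALT: `β_k ≡ −1` at even scales, `≡ 3` at odd scales (history-independent). A TOY MODEL. -/
def betaAlt : HBeta := fun k _ => if Even k then -1 else 3

/-- Its anchor sequence. -/
def bAlt : ℕ → ℝ := fun k => if Even k then -1 else 3

/-- TOY ALT carries the WHOLE corner currency: moduli with the ZERO modulus (hence row mass 0 and any fading letter), the anchor `bAlt` (`ScaleAnchor`), K1⁹'s rows (i) radius 0,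
(iv) floor −1, (C), at every level. [folklore] -/
theorem betaAlt_cornerCurrency {γ₀ : ℝ} :
    HistLipschitz (fun _ _ => 0) γ betaAlt ∧ (∀ k, ∑ i : Fin (k + 1), |(fun _ _ => (0 : ℝ)) k i| ≤ 0) ∧ ScaleAnchor betaAlt bAlt ∧
      RunConstRemainder betaAlt bAlt 0 γ₀ ∧ RunwiseFloor betaAlt γ₀ 1 ∧ SurvCont betaAlt γ₀ := by
  refine ⟨fun k p q _ _ => by simp [betaAlt], fun k => by simp, fun k δ hδ => ⟨1, one_pos, fun p _ => by simp [betaAlt, bAlt, hδ.le]⟩,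
    fun n gs _ _ k _ => by simp [betaAlt, bAlt], fun n gs _ _ k hk => ?_, fun k => ?_⟩
  · -- window sums of the alternating sequence are ≥ −1
    have key : ∀ m, k ≤ m → (if Even m then (0 : ℝ) else -1) ≤ (if Even k then (0 : ℝ) else -1) + ∑ j ∈ Ico k m, bAlt j := by
      intro m hm
      induction m, hm using Nat.le_induction with
      | base => split_ifs <;> simp
      | succ m hm ih =>
        rw [Finset.sum_Ico_succ_top hm, ← add_assoc]
        rcases Nat.even_or_odd m with he | ho
        · have hne : ¬Even (m + 1) := Nat.not_even_iff_odd.mpr he.add_one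
          simp only [he, if_true, hne, if_false, bAlt] at ih ⊢
          linarith
        · have hne : ¬Even m := Nat.not_even_iff_odd.mpr ho
          have he : Even (m + 1) := ho.add_one
          simp only [he, if_true, hne, if_false, bAlt] at ih ⊢
          linarith
    have h := key n hk
    have hsum : ∑ j ∈ Ico k n, betaAlt j (prefixOf gs j) = ∑ j ∈ Ico k n, bAlt j := Finset.sum_congr rfl fun j _ => by simp [betaAlt, bAlt]
    rw [hsum]
    have h1 : (-1 : ℝ) ≤ (if Even n then (0 : ℝ) else -1) := by split_ifs <;> norm_num
    have h2 : (if Even k then (0 : ℝ) else -1) ≤ 0 := by split_ifs <;> norm_num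
    linarith
  · simp only [betaAlt]; exact continuousOn_const

/-- … and the `OneLoopDrift` letter of the 2ᶜᴰ road with slope 1: `|Σ_{j<k} bAlt_j − k| ≤ 2`. [folklore] -/
theorem oneLoopDrift_bAlt : OneLoopDrift 1 2 bAlt := by
  have key : ∀ k : ℕ, ∑ j ∈ range k, bAlt j = if Even k then (k : ℝ) else (k : ℝ) - 2 := by
    intro k
    induction k with
    | zero => simp
    | succ k ih =>
      rw [Finset.sum_range_succ, ih]
      rcases Nat.even_or_odd k with he | ho
      · have hne : ¬Even (k + 1) := Nat.not_even_iff_odd.mpr he.add_one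
        simp only [he, if_true, hne, if_false, bAlt]; push_cast; ring
      · have hne : ¬Even k := Nat.not_even_iff_odd.mpr ho
        have he : Even (k + 1) := ho.add_one
        simp only [he, if_true, hne, if_false, bAlt]; push_cast; ring
  intro k
  rw [key k]
  split_ifs <;> simp

/-- **★ THE (α♭) INPUT IS NOT IMPLIED BY THE CORNER CURRENCY**: TOY ALT has NO run of (0.20) of depth 1 obeying (0.31) at ANY slope `s > 0` (`topStep_lower_of_discrete031` would give
`s ≤ β_0 = −1`), although it carries moduli (zero modulus, zero row mass, any fading letter), anchor, `OneLoopDrift 1 2`, and K1⁹'s rows at every level (`betaAlt_cornerCurrency`,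
`oneLoopDrift_bAlt`).  So bflow-p2's displayed run family is a GENUINELY DIFFERENT located input from 2ᶜᴰ's drift letter: it is a POINTWISE-AF datum at the top of every run.
A TOY MODEL. [cite: Balaban1987RG1, (0.31) p.259 with (0.20) p.256] -/
theorem no_run031_betaAlt (hs : 0 < s) : ¬ ∃ r : ℕ → ℝ, RGEqH 1 betaAlt r ∧ Step.InInterval γ 1 r ∧ Step.Discrete031 s s' 1 (r 1) r := by
  rintro ⟨r, hrg, -, hD⟩
  have h := topStep_lower_of_discrete031 le_rfl hrg hD
  simp [betaAlt] at h
  linarith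

/-- TOY F (the kernel's §9b `betaMT`, re-declared): `β_k(p) = 1 + p_0²∕(1 + k p_0²)` — FIRST-ENTRY-ONLY, values in [1, 1 + γ²] on the γ-box. A TOY MODEL. -/
def betaMT : HBeta := fun k p => 1 + (p 0) ^ 2 / (1 + k * (p 0) ^ 2)

/-- Its history modulus: weight `2γ` on the first entry only (row mass `2γ`, NOT fading — kernel §9b `not_histLipschitz_fadingMemory_betaMT`). -/
def lamMT (γ : ℝ) : ℕ → ℕ → ℝ := fun _ i => if i = 0 then 2 * γ else 0

theorem betaMT_bounds {k : ℕ} {p : Fin (k + 1) → ℝ} (hp : p ∈ Box γ k) : 1 ≤ betaMT k p ∧ betaMT k p ≤ 1 + γ ^ 2 := by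
  have h0 := (mem_box.mp hp) 0
  have hx2 : 0 ≤ (p 0) ^ 2 := sq_nonneg _
  have hden : 1 ≤ 1 + (k : ℝ) * (p 0) ^ 2 := by
    have : 0 ≤ (k : ℝ) * (p 0) ^ 2 := by positivity
    linarith
  have hfrac0 : 0 ≤ (p 0) ^ 2 / (1 + k * (p 0) ^ 2) := by positivity
  have hfrac : (p 0) ^ 2 / (1 + k * (p 0) ^ 2) ≤ γ ^ 2 := by
    rw [div_le_iff₀ (by positivity)]
    have h1 : (p 0) ^ 2 ≤ γ ^ 2 := pow_le_pow_left₀ h0.1.le h0.2 2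
    nlinarith
  exact ⟨by unfold betaMT; linarith, by unfold betaMT; linarith⟩

/-- The mean-value estimate for `x ↦ x²∕(1 + k x²)` on [0, γ]: Lipschitz with constant `2γ`. [folklore] -/
theorem abs_mt_sub_mt_le {k : ℕ} {x y : ℝ} (hx : 0 ≤ x) (hxγ : x ≤ γ) (hy : 0 ≤ y) (hyγ : y ≤ γ) :
    |x ^ 2 / (1 + k * x ^ 2) - y ^ 2 / (1 + k * y ^ 2)| ≤ 2 * γ * |x - y| := by
  have hk : (0 : ℝ) ≤ k := Nat.cast_nonneg k
  have hdx : 0 < 1 + (k : ℝ) * x ^ 2 := by positivity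
  have hdy : 0 < 1 + (k : ℝ) * y ^ 2 := by positivity
  have e : x ^ 2 / (1 + k * x ^ 2) - y ^ 2 / (1 + k * y ^ 2) = (x - y) * ((x + y) / ((1 + k * x ^ 2) * (1 + k * y ^ 2))) := by
    field_simp; ring
  rw [e, abs_mul, mul_comm]
  refine mul_le_mul_of_nonneg_right ?_ (abs_nonneg _)
  rw [abs_of_nonneg (by positivity)]
  rw [div_le_iff₀ (by positivity)]
  have h1 : 1 ≤ (1 + (k : ℝ) * x ^ 2) * (1 + k * y ^ 2) := by
    nlinarith [mul_nonneg hk (sq_nonneg x), mul_nonneg hk (sq_nonneg y), mul_nonneg (mul_nonneg hk (sq_nonneg x)) (mul_nonneg hk (sq_nonneg y))]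
  have hγ0 : 0 ≤ γ := hx.trans hxγ
  have h2 : 0 ≤ γ * ((1 + (k : ℝ) * x ^ 2) * (1 + k * y ^ 2) - 1) := mul_nonneg hγ0 (by linarith)
  nlinarith

/-- TOY F carries the moduli with modulus `lamMT γ` (row mass 2γ). [folklore] -/
theorem histLipschitz_betaMT (hγ : 0 < γ) : HistLipschitz (lamMT γ) γ betaMT ∧ ∀ k, ∑ i : Fin (k + 1), |lamMT γ k i| ≤ 2 * γ := by
  refine ⟨fun k p q hp hq => ?_, fun k => ?_⟩
  · have hp0 := (mem_box.mp hp) 0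
    have hq0 := (mem_box.mp hq) 0
    have h := abs_mt_sub_mt_le (k := k) hp0.1.le hp0.2 hq0.1.le hq0.2
    have hsum : ∑ i : Fin (k + 1), lamMT γ k i * |p i - q i| = 2 * γ * |p 0 - q 0| := by
      rw [Finset.sum_eq_single (0 : Fin (k + 1))]
      · simp [lamMT]
      · intro i _ hi; simp [lamMT, hi]
      · intro h; exact absurd (Finset.mem_univ _) h
    rw [hsum]
    have e : betaMT k p - betaMT k q = (p 0) ^ 2 / (1 + k * (p 0) ^ 2) - (q 0) ^ 2 / (1 + k * (q 0) ^ 2) := by unfold betaMT; ring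
    rw [e]; exact h
  · have hsum : ∑ i : Fin (k + 1), |lamMT γ k i| = |2 * γ| := by
      rw [Finset.sum_eq_single (0 : Fin (k + 1))]
      · simp [lamMT]
      · intro i _ hi; simp [lamMT, hi]
      · intro h; exact absurd (Finset.mem_univ _) h
    rw [hsum, abs_of_pos (by positivity)]

/-- **★ (α♭) IS INHABITED BY TOY F** — where the fading ∕ NE4 roads are EMPTY (kernel §9b: `not_histLipschitz_fadingMemory_betaMT`, `not_scaleShiftRate_betaMT`): `betaMT` carries
`HistLipschitz (lamMT γ) γ` with row mass `2γ` AND, for every depth K, a run of (0.20) inside ]0, γ] with `Step.Discrete031 1 (1+γ²) K (r_K) r` (every in-window run qualifies since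
`1 ≤ β ≤ 1 + γ²` on the box; deep in-window runs exist by `deepRun_of_runUpper`).  Hence §B's road is non-vacuous off the rate letters.  A TOY MODEL.
[cite: Balaban1987RG1, Thm 2 (0.31) p.259 with (0.20) p.256] -/
theorem alphaFlat_inhabited_betaMT (hγ : 0 < γ) :
    HistLipschitz (lamMT γ) γ betaMT ∧ (∀ k, ∑ i : Fin (k + 1), |lamMT γ k i| ≤ 2 * γ) ∧
      ∀ K : ℕ, ∃ r : ℕ → ℝ, RGEqH K betaMT r ∧ Step.InInterval γ K r ∧ Step.Discrete031 1 (1 + γ ^ 2) K (r K) r := by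
  obtain ⟨hL, hM⟩ := histLipschitz_betaMT hγ
  refine ⟨hL, hM, fun K => ?_⟩
  have hB : ∀ (j : ℕ) (gs : ℕ → ℝ), RGEqH j betaMT gs → Step.InInterval γ j gs → betaMT j (prefixOf gs j) ≤ 1 + γ ^ 2 :=
    fun j gs _ hI => (betaMT_bounds (prefixOf_mem_box_of_inInterval hI le_rfl)).2
  obtain ⟨r, hrg, hI⟩ := deepRun_of_runUpper hγ (fun _ => by positivity) hB K
  refine ⟨r, hrg, hI, fun k hk => ?_⟩
  have htel := inv_sq_telescopeH hrg hk le_rfl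
  have hcard : ((#(Ico k K) : ℕ) : ℝ) = (K : ℝ) - k := by rw [Nat.card_Ico, Nat.cast_sub hk]
  have hlo : ∑ j ∈ Ico k K, (1 : ℝ) ≤ ∑ j ∈ Ico k K, betaMT j (prefixOf r j) :=
    Finset.sum_le_sum fun j hj => (betaMT_bounds (prefixOf_mem_box_of_inInterval hI (mem_Ico.mp hj).2.le)).1
  have hhi : ∑ j ∈ Ico k K, betaMT j (prefixOf r j) ≤ ∑ j ∈ Ico k K, (1 + γ ^ 2 : ℝ) :=
    Finset.sum_le_sum fun j hj => (betaMT_bounds (prefixOf_mem_box_of_inInterval hI (mem_Ico.mp hj).2.le)).2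
  rw [Finset.sum_const, nsmul_eq_mul, hcard] at hlo hhi
  constructor <;> linarith

/-! ### TOY G — the CONVERSE separation: (α♭) + U3ᴷ-lite + rows do NOT give 2ᶜᴰ's drift letter -/

/-- TOY G's value sequence: `1` on the blocks `[m², (m+1)²)` with `m` even, `2` on those with `m` odd (block lengths `2m+1 → ∞`). -/
def cBlk : ℕ → ℝ := fun k => if Even (Nat.sqrt k) then 1 else 2

/-- TOY G: the history-free β with `β_k ≡ cBlk k`. A TOY MODEL (not Bałaban's β). -/
def betaBlk : HBeta := fun k _ => cBlk k

theorem one_le_cBlk (k : ℕ) : 1 ≤ cBlk k ∧ cBlk k ≤ 2 := by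
  unfold cBlk; split_ifs <;> norm_num

/-- On the block `[m², (m+1)²)` the integer square root is `m`. [folklore] -/
theorem sqrt_eq_of_mem_block {m j : ℕ} (h1 : m ^ 2 ≤ j) (h2 : j < (m + 1) ^ 2) : Nat.sqrt j = m := by
  have ha : m ≤ Nat.sqrt j := Nat.le_sqrt'.mpr h1
  have hb : Nat.sqrt j < m + 1 := Nat.sqrt_lt'.mpr h2
  omega

/-- The block sum: `Σ_{j ∈ [m², (m+1)²)} cBlk j = (2m+1) · v_m` with `v_m = 1` (m even) ∕ `2` (m odd). [folklore] -/
theorem sum_block_cBlk (m : ℕ) :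
    ∑ j ∈ Ico (m ^ 2) ((m + 1) ^ 2), cBlk j = (2 * (m : ℝ) + 1) * (if Even m then 1 else 2) := by
  have hc : ∀ j ∈ Ico (m ^ 2) ((m + 1) ^ 2), cBlk j = (if Even m then (1 : ℝ) else 2) := by
    intro j hj
    rw [mem_Ico] at hj
    simp only [cBlk, sqrt_eq_of_mem_block hj.1 hj.2]
  rw [Finset.sum_congr rfl hc, Finset.sum_const, Nat.card_Ico, nsmul_eq_mul]
  congr 1
  have h : (m + 1) ^ 2 - m ^ 2 = 2 * m + 1 := by
    have : m ^ 2 ≤ (m + 1) ^ 2 := Nat.pow_le_pow_left (Nat.le_succ m) 2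
    zify [this]; ring
  rw [h]; push_cast; ring

/-- TOY G carries (α♭) with the ZERO modulus (row mass 0): for every depth K a run of (0.20) inside ]0, γ] with `Step.Discrete031 1 2 K (r_K) r` (since `1 ≤ β ≤ 2`),
together with the anchor `cBlk` and K1⁹'s three rows at every level (radius 0, floor 0, (C)). [folklore] -/
theorem alphaFlat_rows_betaBlk (hγ : 0 < γ) {γ₀ : ℝ} :
    HistLipschitz (fun _ _ => 0) γ betaBlk ∧ (∀ k, ∑ i : Fin (k + 1), |(fun _ _ => (0 : ℝ)) k i| ≤ 0) ∧
      (∀ K : ℕ, ∃ r : ℕ → ℝ, RGEqH K betaBlk r ∧ Step.InInterval γ K r ∧ Step.Discrete031 1 2 K (r K) r) ∧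
      ScaleAnchor betaBlk cBlk ∧ RunConstRemainder betaBlk cBlk 0 γ₀ ∧ RunwiseFloor betaBlk γ₀ 0 ∧ SurvCont betaBlk γ₀ := by
  refine ⟨fun k p q _ _ => by simp [betaBlk], fun k => by simp, fun K => ?_, fun k δ hδ => ⟨1, one_pos, fun p _ => by simp [betaBlk, hδ.le]⟩,
    fun n gs _ _ k _ => by simp [betaBlk], fun n gs _ _ k hk => ?_, fun k => ?_⟩
  · have hB : ∀ (j : ℕ) (gs : ℕ → ℝ), RGEqH j betaBlk gs → Step.InInterval γ j gs → betaBlk j (prefixOf gs j) ≤ 2 :=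
      fun j gs _ _ => (one_le_cBlk j).2
    obtain ⟨r, hrg, hI⟩ := deepRun_of_runUpper hγ (fun _ => by norm_num) hB K
    refine ⟨r, hrg, hI, fun k hk => ?_⟩
    have htel := inv_sq_telescopeH hrg hk le_rfl
    have hcard : ((#(Ico k K) : ℕ) : ℝ) = (K : ℝ) - k := by rw [Nat.card_Ico, Nat.cast_sub hk]
    have hlo : ∑ j ∈ Ico k K, (1 : ℝ) ≤ ∑ j ∈ Ico k K, betaBlk j (prefixOf r j) := Finset.sum_le_sum fun j _ => (one_le_cBlk j).1
    have hhi : ∑ j ∈ Ico k K, betaBlk j (prefixOf r j) ≤ ∑ j ∈ Ico k K, (2 : ℝ) := Finset.sum_le_sum fun j _ => (one_le_cBlk j).2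
    rw [Finset.sum_const, nsmul_eq_mul, hcard] at hlo hhi
    constructor <;> linarith
  · -- window sums of a sequence ≥ 1 are ≥ 0 ≥ −0
    have h : (0 : ℝ) ≤ ∑ j ∈ Ico k n, betaBlk j (prefixOf gs j) := Finset.sum_nonneg fun j _ => by
      have := (one_le_cBlk j).1; simp only [betaBlk]; linarith
    linarith
  · simp only [betaBlk]; exact continuousOn_const

/-- `cBlk` admits NO linear drift: for every slope `s` and constant `A`, `¬ OneLoopDrift s A cBlk` — on a block of length `2m+1 > 4A` of the parity where `|v_m − s| ≥ 1∕2` the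
window sum moves `≥ (2m+1)∕2 > 2A` away from the line (`abs_sum_Ico_sub_le_of_drift`). [folklore] -/
theorem no_oneLoopDrift_cBlk (s A : ℝ) : ¬ OneLoopDrift s A cBlk := by
  intro h
  have hA : 0 ≤ A := h.nonneg
  -- a window bound on every block
  have hwin : ∀ m : ℕ, |(2 * (m : ℝ) + 1) * (if Even m then 1 else 2) - s * (2 * (m : ℝ) + 1)| ≤ 2 * A := by
    intro m
    have hle : m ^ 2 ≤ (m + 1) ^ 2 := Nat.pow_le_pow_left (Nat.le_succ m) 2
    have := Beta.Drift.abs_sum_Ico_sub_le_of_drift h hle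
    rw [sum_block_cBlk m] at this
    have hcast : (((m + 1) ^ 2 : ℕ) : ℝ) - ((m ^ 2 : ℕ) : ℝ) = 2 * (m : ℝ) + 1 := by push_cast; ring
    rwa [hcast] at this
  obtain ⟨M, hM⟩ := exists_nat_ge (2 * A)
  rcases le_or_gt s (3 / 2) with hs | hs
  · -- use the odd block m = 2M+1 (value 2, 2 − s ≥ 1/2)
    have h1 := hwin (2 * M + 1)
    have hodd : ¬Even (2 * M + 1) := Nat.not_even_iff_odd.mpr (by exact ⟨M, rfl⟩)
    rw [if_neg hodd] at h1
    have h2 := (abs_le.mp h1).2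
    push_cast at h2
    nlinarith
  · -- use the even block m = 2M (value 1, s − 1 ≥ 1/2)
    have h1 := hwin (2 * M)
    have heven : Even (2 * M) := ⟨M, by ring⟩
    rw [if_pos heven] at h1
    have h2 := (abs_le.mp h1).1
    push_cast at h2
    nlinarith

/-- **★ TOY G — THE CONVERSE SEPARATION: (α♭) + U3ᴷ-lite + K1⁹'s rows do NOT imply 2ᶜᴰ's drift letter.**  `betaBlk` carries the zero modulus (every mass ∕ fading letter), runs of
(0.20) of EVERY depth obeying (0.31) with slopes (1, 2), the anchor, rows (i)(iv)(C) at every level (`alphaFlat_rows_betaBlk`) — yet NO anchored sequence `b` has `OneLoopDrift s A b` for ANY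
slope `s` (not only `s > 0`): the anchor is unique (`ScaleAnchor.eq`), so `b = cBlk`, and `no_oneLoopDrift_cBlk`.  With TOY ALT (`no_run031_betaAlt`) the two located AF inputs — bflow-p2's
displayed run family and 2ᶜᴰ's `CornerDriftPos` conclusion shape `∃ b s A, ScaleAnchor β b ∧ 0 < s ∧ OneLoopDrift s A b` — are INCOMPARABLE on the β side, and T14♭'s bracket «drift s > 0 ⟹
ROWS ⟹ floor(b)» is STRICT AT THE TOP off the seam (window averages of `b` here lie in [1, 2]).  A TOY MODEL. [cite: Balaban1987RG1, (0.31) p.259, (1.3) p.260, (1.22) p.264] -/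
theorem no_anchoredDrift_betaBlk : ¬ ∃ (b : ℕ → ℝ) (s A : ℝ), ScaleAnchor betaBlk b ∧ OneLoopDrift s A b := by
  rintro ⟨b, s, A, hb, hd⟩
  have hanchor : ScaleAnchor betaBlk cBlk := fun k δ hδ => ⟨1, one_pos, fun p _ => by simp [betaBlk, hδ.le]⟩
  have hbc : b = cBlk := ScaleAnchor.eq hb hanchor
  subst hbc
  exact no_oneLoopDrift_cBlk s A hd

end Price



end

end Summit.QuantumFields.YangMills.Cruxes.EndpointGivenBR13SepCoPH.Idea7RunCurrency
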